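import Summits.AtomisticToContinuum.Crystallization.Theses.PalmUnimodularRigidity
import Literature.Probability.Process.PointStationaryLaw
import Literature.MathematicalPhysics.StatisticalMechanics.RootEnergy

/-!
# Disproof of `MinimiserShells` — findings (cdisprove seat, crux `stmt-AtomisticToContinuum-9225`, gen 1–3)

Crux (route `PalmUnimodularRigidity`, rank 2; `minimiserShells_iff` below is `Iff.rfl`):
for every `δ > 0` and every probability law `P` on rooted configurations `μ : Measure ℝ³` that is
(i) a.s. `δ`-hard-core rooted (`IsRootedHardCore δ`), (ii) point-stationary (Mecke identity,
`IsPointStationaryLaw`), (iii) minimising (`E_P[h] ≤ e* := ⨅_Q e_LJ(Q)`, `h μ = ½∫V_LJ(‖y‖)dμ`),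
P-a.s. the root shell `{y ≠ 0 : μ{y} ≠ 0, ‖y‖ ≤ 5a/4}` is `(a/100)`-matched, after a linear isometry,
to the `a`-scaled FCC or HCP kissing pattern for some `a ∈ [9/10, 1]` (`GoodShell μ`).

VERDICT (standing, gens 1–3): **resists a Lean kill by construction.**  `¬ MinimiserShells` needs a
law `P` satisfying (i)–(iii) with `P(bad root shell) > 0`.  Hypothesis (iii) is the obstruction: by
§3 below any minimising law has `E_P[h] = e*` exactly unless 9229 fails, and exhibiting ANY law with
`E_P[h] ≤ e*` in Lean means certifying `e(Q) = e*` for an explicit periodic `Q` (the Lennard-Jones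
lattice problem: hcp vs fcc vs polytypes at relative `1e-4`, uncertified `r⁻⁶` tail — item 0670) or
an abstract compactness construction (Benjamini–Schramm limit, item 9230) that gives no handle on
the shells.  A refutation of this crux IS a negative solution of the 3-D LJ crystal problem
(a non-close-packed minimising law); nothing cheaper exists.  What CAN be certified is which
hypotheses carry the load, which natural strengthenings are false, and what the crux secretly
contains — all below, sorry-free unless marked `near-miss`.

## Index of findings

* §0 read-back: `minimiserShells_iff`, `unimodularEnergyLowerBound_iff` (`Iff.rfl` against the
  Literature vocabulary `IsRootedHardCore` / `IsPointStationaryLaw`; `meanRootEnergy`, `eStar`,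
  `GoodShell` are the route's inlined terms verbatim).  No junk: `V_LJ(0) = 0` makes the root's own
  atom harmless (`meanRootEnergy_dirac_dirac_zero`); `e*` is a genuine infimum iff 0714 (not used).
* §1 shell bookkeeping: `not_goodShell_of_far` (empty `5/4`-ball ⇒ bad: a good shell has 12 points,
  `card_fccKissingPattern`/`card_hcpKissingPattern` + injectivity of `a • ·`), `not_goodShell_dirac_zero`.
* §2 LOAD-BEARING HYPOTHESES (each dropped in turn, witness certified):
  - §2a energy `E_P[h] ≤ e*` dropped ⇒ FALSE: lone root `δ_{δ_0}` (`minimiserShells_false_without_energy`;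
    tree facts `isPointStationaryLaw_dirac_dirac_zero`, `isRootedHardCore_dirac_zero`).
  - §2b point-stationarity dropped ⇒ FALSE: the COLLINEAR COMB `{0} ∪ {(3/2 + k/(2m+2))e₀ : k < m}`,
    `m = ⌈−2000 e*⌉₊`, is `1/(2m+2)`-hard-core, has ROOT energy `≤ −m/2000 ≤ e*` (each comb point gives
    `V_LJ ≤ −1/1000` on `[3/2, 2]`, `lennardJones_le_on_comb_annulus`) and an EMPTY root shell
    (`minimiserShells_false_without_stationarity`, via `measurableSet_setOf_eq_count_restrict` — the
    Giry σ-algebra separates `count|F`, `F` finite — and `meanRootEnergy_dirac_count_restrict`).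
    Moral: `E_P[h] ≤ e*` localises NOTHING by itself; every bit of shell structure must come from
    re-rooting (Mecke) — the energy of the root's NEIGHBOURS is what prices the root's shell.
  - probability / hard core: decoration-level (a finite non-zero `P` rescales; `δ` only has to be
    small — the statement is monotone in `δ`, `IsRootedHardCore.mono`); not attacked further.
* §2c NATURAL STRENGTHENING refuted: the POINTWISE version ("root energy `≤ e*` ⇒ good root shell",
  `not_pointwiseMinimiserShells`) — same comb.  Consequence for certificate lines (cards
  slack-tolerant-dense-certificate, octahedral-annulus-mandate, TwoShellAnnulusCertificate): a
  transfer-free pointwise certificate `h(μ) ≥ e* + c·1[bad]` is FALSE; the transfer term is not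
  optional, and it must move `≥ |e*|`-sized masses (the comb's root sits at `≤ e*` with NO neighbour
  within `3/2`).
* §3 HIDDEN DEPENDENCY (new): `minimiserShells_imp_unimodularEnergyLowerBound :
  MinimiserShells → UnimodularEnergyLowerBound` (items 9225 ⇒ 9229), by mixing a hypothetical
  sub-`e*` law with the lone root (`meanRootEnergy_mix_le`; convex-cone closure
  `IsPointStationaryLaw.add/.smul`; the Bochner junk case `¬Integrable` is handled).  Refuter form:
  `minimiserShells_false_of_not_unimodularEnergyLowerBound`.  So the crux is AT LEAST as strong as
  `e_uni ≥ e*` (rank-9 support, difficulty L, not in the `closes` chain): the planner should make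
  9229 an explicit prerequisite of every line on 9225, and a prover of 9225 must in effect prove
  the random-grid periodisation bound first.
* §4 UNIFORMLY ROOTED FINITE CONFIGURATIONS and the SLACK versions (all certified):
  `unifRooted x = (1/N) Σ_i δ_{count|(x − x_i)}` is point-stationary EXACTLY
  (`isPointStationaryLaw_unifRooted`, finite double count — the first lemma of item 9230), a.s.
  hard-core at the configuration's own minimal distance (`ae_isRootedHardCore_unifRooted`), and
  `E_{P_x}[h] = 𝓔_N(x)/N` EXACTLY (`meanRootEnergy_unifRooted`).  Consequences:
  - `MinimiserShellsSlack s` (`E_P[h] ≤ e* + s ⇒ a.s. good shell`; slack `0` = the crux,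
    `minimiserShellsSlack_zero_iff`) is refuted for `s ≥ −e*` by the lone root
    (`not_minimiserShellsSlack_of_neg_eStar_le`), by ANY point-stationary hard-core law of energy
    `< e* + s` (`not_minimiserShellsSlack_of_law`, via `exists_bad_mix`), hence for EVERY `s > 0`
    modulo the soft support item 0626 (`not_minimiserShellsSlack_of_crysEnergyLimit`: uniformly
    rooted ground states, `exists_isGroundState_separated` + `E(N)/N → e*`).  So no proof of the
    crux can be stable under `E_P[h] ↦ E_P[h] + s`: it must use EXACT minimality — a first-order
    mechanism `E_P[h] ≥ e* + c·P(bad)` — and by §2c `c` cannot come from a pointwise certificate.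
  - the constant in that intended inequality `E_P[h] ≥ e* + c·P(bad root shell)` is TINY:
    `c ≤ e(Q_bad) − e*` for every periodic `Q_bad` all of whose shells are bad.  Deviatoric strains of
    relaxed fcc/hcp just beyond the `a/100` matching tolerance (≈ 1.5–2 % shear; the free scale `a`
    and the free rotation absorb dilations/rotations) cost ≈ ½·C′·η²·v ≈ 1e-3·|e*| per particle
    (LJ elastic moduli ≈ 50–75 ε/σ³): any certificate must resolve the LJ energy landscape to
    relative 1e-3 uniformly over configurations — flyspeck-grade precision on a soft landscape.
    bcc (all shells bad: 8+6 = 14 points within `5a/4`) costs only 4.3 %; the scale window costs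
    ≥ 2.6 % (a = 1) resp. ≫ (a = 9/10): not the weak spot.
* §5 THE INTENDED MECHANISM `LinearPricing c : e* + c·P(bad) ≤ E_P[h]`: sufficient for every `c > 0`
  (`minimiserShells_of_linearPricing`), contains 9229 (`unimodularEnergyLowerBound_of_linearPricing`),
  and CAPPED by every a.s.-bad point-stationary hard-core law (`linearPricing_ceiling : c ≤ E_P[h] − e*`);
  numerics (kit j008791): tetragonally strained fcc at the 1 % matching threshold ⇒ `c ≤ 4.4e-4`
  (0.06 % of |e*|) — the precision any certificate for the fine target must reach.
* §6 (cycle 2) NORMALISATIONS AND SYMMETRY ARE LOAD-BEARING — three more hypothesis mutations, each FALSE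
  with a certified witness built on the DIMER `{0, u₀}` (`pair`, energy `E(2)/2 = −1/24` per root, ONE
  shell point) or on the SYMMETRIC COMB:
  - §6a `IsProbabilityMeasure P` weakened to "finite, non-zero" ⇒ FALSE (`minimiserShells_false_without_normalisation`,
    witness `n • P_dimer`, `n = ⌈−24e*⌉₊ + 1`): `E_P[h] ≤ e*` is 1-homogeneous in `P`, the conclusion 0-homogeneous.
  - §6b the UNIT-MASS clause of (i) (`μ = count|S`) relaxed to a common integer multiplicity
    `μ = k • count|S` (`IsRootedHardCoreMult` — exactly the multiplicities `m ≥ 1` the summit's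
    `IsCrystallizing` tolerates) ⇒ FALSE (`minimiserShells_false_without_unitMass`): Mecke SURVIVES
    `μ ↦ k • μ` (`isPointStationaryLaw_multRooted`), energy is multiplied by `k`
    (`meanRootEnergy_multRooted`), shells are unchanged.  Moral for LP/flow-type certificates over
    "Palm two-point data with Mecke constraints": the constraint set is a CONE in `μ`; the proof must use
    the integrality/unit mass of atoms (one unit of probability per particle), which no linear
    constraint in `μ` expresses.
  - §6c point-stationarity weakened to REFLECTION SYMMETRY of the law (`IsReflectionSymmetricLaw`: Mecke
    for transports `g(μ, y) = k(y)` blind to the configuration) ⇒ FALSE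
    (`minimiserShells_false_withReflectionOnly`, witness: the deterministic symmetric comb `symComb`).
    So the proof must re-root GENUINELY (`g` depending on `θ_y μ`); evenness of the Palm intensity is free
    and useless.
* §7 (cycle 2) ROOTEDNESS IS FREE: `minimiserShellsUnrooted_iff : MinimiserShellsUnrooted ↔ MinimiserShells`
  — the clause `0 ∈ S` of (i) can be deleted.  Mechanism (all certified): Mecke with `g(μ,y) = 1[μ{0} = 0]`
  forces `0 ∈ S ∨ S = ∅` a.s. (`ae_root_or_eq_zero`; uses `countable_of_separated`: separated sets are
  countable hence measurable); `S = ∅` with probability `1 − p ∈ (0,1)` makes the CONDITIONED law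
  `p⁻¹ • P|{S ≠ ∅}` point-stationary (`isPointStationaryLaw_restrict`: conditioning on a
  re-rooting-invariant event) with energy `E/p < e*` (as `e* < 0`, forced by the crux via the lone root),
  contradicting `e_uni ≥ e*` (§3).  Provers: `isPointStationaryLaw_restrict` is the ergodic-component /
  conditioning tool every density argument needs (`isPointStationaryLaw_restrict_ae`: invariance only
  `P`-a.s./`μ`-a.e.); `ae_root_or_eq_zero` is the first Mecke computation.
  §7b `meanRootEnergy_cond_le_of_minimising`: given `e_uni ≥ e*` and `e* < 0`, conditioning a
  minimising law on an invariant event of positive probability keeps it minimising (linearity of `E_P[h]`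
  + `e_uni ≥ e*` on both pieces) — the ergodic-component step every density argument uses.
* §8 (cycle 2) `linearPricing_ceiling_partial`: `c ≤ (E_P[h] − e*)/q` whenever `P(bad) ≥ q` — the dilute
  defect version of §5's ceiling.  NUMERICS (kit j010609, 72 s, numpy; pair sums over a fixed undeformed
  index set `|R| ≤ 12` + exact continuum tail of the deformed region, so energies are smooth in the strain;
  uncertified): relaxed fcc `a* = 0.971234`, `e_fcc = −0.7175150`; relaxed hcp `a* = 0.971274`,
  `c/a = 1.632764` (ideal − 2.3e-4), in-plane vs out-of-plane NN `0.971274` vs `0.971183`, `e_hcp = −0.7175904`,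
  `e_hcp − e_fcc = −7.5e-5` (1.05e-4 relative).  HARMONIC AND ELASTIC STABILITY (loophole (d) closed
  numerically): min phonon `ω²` over the BZ grid (`k ≠ 0`) fcc `0.417` (20³), hcp `0.291` (20²×12, six
  branches, none negative; `ω²(Γ) = 0,0,0,17.1,17.1,83.4`), acoustic slopes `ω²/|k|² ≥ 0.33 / 0.41`, on-site
  stiffness `39.6`; elastic constants (energy/r₀³) fcc `C11 = 12.40, C12 = 7.09, C44 = 7.09` (Cauchy
  `C12 = C44` to 2e-4 — a check), hcp with internal relaxation `C11 = 15.77, C12 = 6.67, C13 = 4.14 = C44,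
  C33 = 18.31, C66 = 4.55 = (C11 − C12)/2`; all Born criteria positive with margins `5.3, 26.6, 7.1` (fcc),
  `9.1, 377, 4.1, 4.5` (hcp) [textbook counterpart: Dove 1993, Introduction to Lattice Dynamics, §2 worked
  example pp. 61–62, Figs 2.7–2.10 — the LJ fcc model reproduces the all-real measured dispersion of solid
  Ar/Kr/Xe].  CEILINGS ON `c` (per particle, relaxed hcp base = `e*` assumed): homogeneous strain at the
  `a/100` threshold — in-plane deviatoric `diag(1+η,1−η,1)`, bad from `η = 1 %`: `5.6e-4`; axial deviatoric
  bad from `η ≈ 1.15 %`: `≈ 9e-4`; basal / prism simple shear bad from `γ ≈ 2 %`: `5.9e-4 / 5.4e-4`; fcc base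
  `diag(1+η,1−η,1)` at `1 %`: `3.4e-4` (+ `7.5e-5` offset if hcp is the minimiser); single displaced atom
  (frozen surroundings, hcp) `ΔE = 1.87e-3` at `|u| = a/100` (own shell bad: `c ≤ 1.9e-3`) and `7.5e-3` at
  `2a/100` (13 shells bad: `c ≤ 5.8e-4`).  So `c ≲ 4–6 × 10⁻⁴ ≈ 0.06–0.08 %·|e*|` from every direction:
  point defects do not beat homogeneous strain, and no zero-cost distortion exists at harmonic order.
* §9 (gen 3) FINITE-RANGE MASS TRANSPORT IS NOT ENOUGH, AT ANY RANGE: `IsLocallyPointStationaryLaw R`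
  (Mecke only for transports `g` with `g(μ, y) = 0` for `‖y‖ > R`) and
  `minimiserShells_false_withLocalMecke : ∀ R, ¬ MinimiserShellsWithLocalMecke R`.  Witness: the
  deterministic FAR COMB `δ_{count|F}`, `F = {0} ∪ {(R + 3/2 + k/(2m+2))e₀ : k < m}`, `m = ⌈−24(R+2)⁶e*⌉₊`
  — range-`R` transports out of / into the root see only the root (`isLocallyPointStationaryLaw_dirac_of_far`),
  root energy `≤ e*` (`lennardJones_le_of_one_le`: `V_LJ ≤ −1/(12ρ⁶)` on `[1, ρ]`), empty shell.  With §2b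
  (`R = 0`) and §6c this brackets the transports a proof must use: GENUINELY re-rooting (`g` depends on
  `θ_yμ`) AND of UNBOUNDED metric range (`R → ∞`, as in the Palm-density lemma and in 9229's random grid);
  bounded-radius shell/star/ring bookkeeping plus `E_P[h] ≤ e*` is consistent with the far comb.
  Landing: `Negative/LocalMecke.lean` (gen 3).
* §4b (gen 3) `not_minimiserShellsSlack : 0 < s → ¬ MinimiserShellsSlack s` UNCONDITIONALLY (0626 is proved in
  the tree: `Theorems.crysEnergyLimit_proof`), and `nonpos_of_minimiserShellsSlack`.
* §10 (gen 3) non-vacuity of the conclusion: `goodShell_cuboctahedralCluster`, `goodShell_anticuboctahedralCluster`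
  (the 13-atom clusters `{0} ∪ pattern` have a good ROOT shell, `a = 1`, `A = id`) — the inlined
  `ShellCloseTo`/pattern terms carry no junk that would make the crux true for lack of good shells.
* §11 (gen 3) THE FINITE WORLD IS CLOSED: `card_mul_eStar_lt` (`N·e* < 𝓔_N(y)` STRICTLY, two far copies;
  hence `eStar_lt_groundStateEnergy_div`, `eStar_lt_meanRootEnergy_unifRooted` — no uniformly rooted finite
  cluster is minimising) and `exists_not_goodShell_rootedMeasure` / `not_ae_goodShell_unifRooted` (every
  finite cluster has a badly shelled atom: extreme atom + tight-frame identities `Σv = 0`, `Σ⟪v,u⟫² = 4‖u‖²`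
  of BOTH patterns, `decide` on the integer models; `not_goodShell_of_halfSpace`).  A witness against the
  crux must be a law on infinite configurations.  Landing: `Negative/FiniteClusters.lean` (gen 3).
* NOT load-bearing / not attacked: `δ`-separation itself (statement monotone in `δ`; dropping it to
  "locally finite" is believed harmless but "minimising ⇒ a.s. hard core" is a measure-level minimal-
  distance lemma of substance, not a triviality — noted for planners, not certified).
* `-- Targets`: none yet (payload `targets`/`stuck_stubs` empty at gen 1 and gen 2).
* LANDED (Theorems/MinimiserShells/Negative/): `LoadBearing.lean` (p72881: §1–§2), `HiddenDependency.lean`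
  (p72891: §3), `UniformRooting.lean` (p73606: §4: exact Mecke for uniformly rooted clusters, no slack version);
  cycle 2: `MultRooted.lean` (p75443: §6b machinery), `ReflectionOnly.lean` (p75451: §6c), `PricingCeiling.lean`
  (p75460: §5 ceiling + §8), `Rootedness.lean` (p75698: §7; §7b resubmission in flight), `Normalisation.lean` (p75714: §6a–b).
  gen 3: `LocalMecke.lean` (§9) and `FiniteClusters.lean` (§11) — proposals in flight.

## Why it resists — for every refuting strategy (and what that tells the prover)

1. Every hypothesis-satisfying `P` is a minimiser of the LINEAR functional `E_P[h]` on the convex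
   cone of point-stationary hard-core laws, at the value `e*`; by §3 the crux itself forces
   `e_uni = e*`.  A witness against the crux is therefore a minimising law with bad shells of
   positive probability = a non-close-packed zero-temperature LJ phase in the thermodynamic limit.
   Candidates in print are all finite-size or multi-component effects: icosahedral/Mackay clusters
   (E(N)/N > e* strictly for every finite N — finite clusters are never minimising, `E(2n) < 2E(n)`),
   Frank–Kasper / quasicrystalline LJ phases need two species or modified wells (Dzugutov, Roth–
   Henley), D5h shells (negative 4146) are single shells, not laws.  Single-component LJ 12-6 lattice
   sums: hcp −0.717594, fcc −0.717522 (Δ = 7e-5), every other computed structure ≥ 1 % higher.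
2. The formal loopholes are closed: `V_LJ(0) = 0` (no self-energy shift), `δ`-separation makes `h`
   an honest absolutely convergent sum and `E_P[h]` an honest Bochner integral (else it is `0 > e*`…
   if `e* < 0`; if 0714 failed, `e* = 0` junk and the lone root WOULD refute the crux — so 0714 is a
   silent prerequisite too, but it is true), the Mecke identity is the correct two-sided MTP
   (checked on `δ_{δ_0}`, `δ_{count}`, re-rooted pairs), `ShellCloseTo` allows rotations AND
   rotoreflections, the shell set is finite by hard core, and the constants fit relaxed hcp/fcc
   (`a* ≈ 0.9712 ∈ [0.9, 1]`, distortion 3.7e-4 ≪ a/100, second shell √2·a* ≈ 1.373 > 5a/4).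
3. Mixtures, rotations, non-ergodic laws, small `δ`: the conclusion is a.s. and rotation-invariant,
   mixing with anything non-minimising raises `E_P[h]` above `e*` (given 9229), and the statement is
   monotone in `δ`.
4. What WOULD kill it: (a) `¬ 0714` (then `e* = 0`; false), (b) `¬ 9229` (§3; believed false, random-
   grid periodisation), (c) a periodic all-bad-shell structure with `e(Q) ≤ e(hcp)` for the full
   `r⁻⁶` tail (contradicts all lattice-sum numerics by ≥ 1 %), (d) an aperiodic minimising law with
   a positive density of ≥ 1 %-distorted shells at NO energy cost — excluded only by (unproved)
   strict local stability of the close packings; this is the one place a kit computation can still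
   move the needle (phonon spectrum of relaxed hcp/fcc with tail: strictly positive ⇒ (d) needs a
   genuinely different structure, back to (c)).
5. (cycles 2–3) Every cheap mutation of the HYPOTHESES is now certified false or certified harmless:
   energy (§2a), Mecke (§2b; §6c: even keeping reflection symmetry; §9: even keeping it for all
   transports of any fixed finite range `R`), normalisation of `P` (§6a),
   unit atom masses (§6b) are load-bearing; `0 ∈ S` is free (§7); `δ` is monotone.  What is left is
   exactly the content: a measure-level local energy inequality for pair LJ in `d = 3` resolving the
   landscape to `≈ 5e-4·|e*|` (§5, §8) — Flatley–Theil need a three-body term for the analogous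
   finite statement, Blanc–Lewin §2.3 call the pair case open.  No counterexample candidate survives
   the bookkeeping `E_P[h] = e*` + `e_uni ≥ e*`: every known non-close-packed monatomic LJ structure
   sits `≥ 1 %` above hcp/fcc, four orders of magnitude above the stacking scale.
-/

noncomputable section

open MeasureTheory
open scoped ENNReal BigOperators

namespace Summit.AtomisticToContinuum.Crystallization.Cruxes.MinimiserShells.Disproof

open Literature.Probability.Process
open Literature.MathematicalPhysics.StatisticalMechanics
open Literature.Geometry.DiscreteGeometry
open Summit.AtomisticToContinuum.Crystallization.Theses.PalmUnimodularRigidity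
  (MinimiserShells UnimodularEnergyLowerBound)

/-- Euclidean 3-space. -/
abbrev E3 := EuclideanSpace ℝ (Fin 3)

/-! ## §0 Reading the crux back (definitional folding) -/

/-- `e* = ⨅_Q e_LJ(Q)` over periodic configurations (conditionally complete `iInf` on `ℝ`; junk `0`
if the range were not bounded below — it is, item 0714, but nothing below uses that). -/
def eStar : ℝ := ⨅ Q : PeriodicConfiguration 3, Q.energyPerParticle lennardJones

/-- Mean root energy `E_P[h]`, `h μ = ½ ∫ V_LJ(‖y‖) dμ` (Bochner; the route's inlined term). -/
def meanRootEnergy (P : Measure (Measure E3)) : ℝ := ∫ μ, (∫ y, lennardJones ‖y‖ ∂μ) / 2 ∂P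

/-- The crux's conclusion for ONE rooted configuration `μ`: a `(a/100)`-close-packed root shell at
some scale `a ∈ [9/10, 1]` (FCC or HCP pattern, radius `5a/4`). -/
def GoodShell (μ : Measure E3) : Prop :=
  ∃ a : ℝ, 9 / 10 ≤ a ∧ a ≤ 1 ∧ ∃ T : Finset E3,
    (↑T : Set E3) = {y : E3 | μ {y} ≠ 0 ∧ y ≠ 0 ∧ ‖y‖ ≤ 5 / 4 * a} ∧
    (ShellCloseTo (a / 100) T (Finset.image (fun v : E3 => a • v) fccKissingPattern) ∨
      ShellCloseTo (a / 100) T (Finset.image (fun v : E3 => a • v) hcpKissingPattern))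

/-- READ-BACK: the crux is, symbol for symbol, "every minimising point-stationary `δ`-hard-core
probability law has a good root shell a.s." in the vocabulary of
`Literature.Probability.Process` / `RootEnergy`. [folklore] -/
theorem minimiserShells_iff :
    MinimiserShells ↔ ∀ δ : ℝ, 0 < δ → ∀ P : Measure (Measure E3), IsProbabilityMeasure P →
      (∀ᵐ μ ∂P, IsRootedHardCore δ μ) → IsPointStationaryLaw P → meanRootEnergy P ≤ eStar →
      ∀ᵐ μ ∂P, GoodShell μ :=
  Iff.rfl

/-- READ-BACK of the support item 9229 in the same vocabulary. [folklore] -/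
theorem unimodularEnergyLowerBound_iff :
    UnimodularEnergyLowerBound ↔ ∀ δ : ℝ, 0 < δ → ∀ P : Measure (Measure E3),
      IsProbabilityMeasure P → (∀ᵐ μ ∂P, IsRootedHardCore δ μ) → IsPointStationaryLaw P →
      eStar ≤ meanRootEnergy P :=
  Iff.rfl

/-! ## §1 Shell bookkeeping: an empty `5/4`-ball is never a good shell -/

/-- If every configuration point other than the root lies outside the closed ball of radius `5/4`,
the root shell is bad (the shell set is empty, a good shell has twelve points). [folklore] -/
theorem not_goodShell_of_far {μ : Measure E3}
    (h : ∀ y : E3, μ {y} ≠ 0 → y ≠ 0 → (5 : ℝ) / 4 < ‖y‖) : ¬ GoodShell μ := by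
  rintro ⟨a, ha₁, ha₂, T, hT, hclose⟩
  have ha0 : a ≠ 0 := by linarith
  have hTempty : T = ∅ := by
    rw [← Finset.coe_eq_empty, hT]
    ext y
    simp only [Set.mem_setOf_eq, Set.mem_empty_iff_false, iff_false, not_and, not_le]
    intro hy hy0
    calc 5 / 4 * a ≤ 5 / 4 * 1 := by gcongr
      _ < ‖y‖ := by rw [mul_one]; exact h y hy hy0
  have hcard : T.card = 12 := by
    rcases hclose with hc | hc
    · rw [hc.card_eq, Finset.card_image_of_injective _ (smul_right_injective E3 ha0),
        card_fccKissingPattern]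
    · rw [hc.card_eq, Finset.card_image_of_injective _ (smul_right_injective E3 ha0),
        card_hcpKissingPattern]
  rw [hTempty, Finset.card_empty] at hcard
  exact absurd hcard (by norm_num)

/-- The lone root `δ_0` has a bad (empty) shell. [folklore] -/
theorem not_goodShell_dirac_zero : ¬ GoodShell (Measure.dirac (0 : E3)) := by
  refine not_goodShell_of_far fun y hy hy0 => ?_
  exfalso
  apply hy
  rw [Measure.dirac_apply' _ (measurableSet_singleton y)]
  exact Set.indicator_of_notMem (fun h0 : (0 : E3) ∈ ({y} : Set E3) => hy0 (Set.mem_singleton_iff.1 h0).symm) _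

/-- Integration against the law `δ_{δ_0}` evaluates at `δ_0` (no measurability needed: the Giry
σ-algebra separates `δ_0`). [folklore] -/
theorem integral_dirac_dirac_zero (F : Measure E3 → ℝ) :
    ∫ μ, F μ ∂(Measure.dirac (Measure.dirac (0 : E3)) : Measure (Measure E3)) =
      F (Measure.dirac 0) := by
  have hae := ae_dirac_dirac_zero (G := E3) (measurableSet_singleton 0)
  have heq : (fun μ => F μ) =ᵐ[(Measure.dirac (Measure.dirac (0 : E3)) : Measure (Measure E3))]
      fun _ => F (Measure.dirac 0) :=
    hae.mono fun μ hμ => by simp only [hμ]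
  rw [integral_congr_ae heq]
  simp

/-- The lone-root law has mean root energy `0` (`V_LJ(0) = 0` junk at the root itself). [folklore] -/
theorem meanRootEnergy_dirac_dirac_zero :
    meanRootEnergy (Measure.dirac (Measure.dirac (0 : E3))) = 0 := by
  unfold meanRootEnergy
  rw [integral_dirac_dirac_zero]
  simp [lennardJones_zero]

/-! ## §2 LOAD-BEARING HYPOTHESES

### §2a The energy hypothesis `E_P[h] ≤ e*` is load-bearing -/

/-- The crux with the minimising hypothesis `E_P[h] ≤ e*` DROPPED. -/
def MinimiserShellsWithoutEnergy : Prop :=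
  ∀ δ : ℝ, 0 < δ → ∀ P : Measure (Measure E3), IsProbabilityMeasure P →
    (∀ᵐ μ ∂P, IsRootedHardCore δ μ) → IsPointStationaryLaw P → ∀ᵐ μ ∂P, GoodShell μ

/-- **Any proof must use `E_P[h] ≤ e*`.** Witness: the lone root `P = δ_{δ_0}` is a point-stationary
hard-core probability law (tree: `isPointStationaryLaw_dirac_dirac_zero`) with an empty shell.
[folklore] -/
theorem minimiserShells_false_without_energy : ¬ MinimiserShellsWithoutEnergy := by
  intro h
  have hae := ae_dirac_dirac_zero (G := E3) (measurableSet_singleton 0)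
  have hgood := h 1 one_pos (Measure.dirac (Measure.dirac (0 : E3))) inferInstance
    (hae.mono fun μ hμ => by rw [hμ]; exact isRootedHardCore_dirac_zero 1)
    isPointStationaryLaw_dirac_dirac_zero
  obtain ⟨μ, hμg, hμe⟩ := (hgood.and hae).exists
  rw [hμe] at hμg
  exact not_goodShell_dirac_zero hμg

/-! ### §2b Point-stationarity (the Mecke identity) is load-bearing

Witness family ("collinear annulus comb"): the root at `0` plus `m` points on the segment
`[3/2, 2)·e₀`, spacing `1/(2(m+1))`.  Every comb point contributes `V_LJ ≤ −1/1000` to the root and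
nothing lies within `5/4` of the root, so the ROOT energy is `≤ −m/2000 ≤ e*` for `m = ⌈−2000 e*⌉₊`
while the root shell is empty.  Without the Mecke identity the energy of the root says nothing
about the energy of the other points: `E_P[h] ≤ e*` localises nothing by itself. -/

/-- The unit vector `e₀`. -/
def e0 : E3 := EuclideanSpace.single 0 1

/-- The `k`-th comb point `(3/2 + k/(2(m+1))) • e₀`. -/
def combPt (m k : ℕ) : E3 := ((3 : ℝ) / 2 + (k : ℝ) / (2 * ((m : ℝ) + 1))) • e0

/-- The comb configuration: root plus `m` comb points. -/
def comb (m : ℕ) : Finset E3 := insert 0 ((Finset.range m).image (combPt m))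

theorem norm_e0 : ‖e0‖ = 1 := by
  simp [e0]

theorem norm_combPt (m k : ℕ) : ‖combPt m k‖ = 3 / 2 + (k : ℝ) / (2 * ((m : ℝ) + 1)) := by
  rw [combPt, norm_smul, norm_e0, mul_one, Real.norm_of_nonneg (by positivity)]

theorem le_norm_combPt (m k : ℕ) : (3 : ℝ) / 2 ≤ ‖combPt m k‖ := by
  rw [norm_combPt]
  have : (0 : ℝ) ≤ (k : ℝ) / (2 * ((m : ℝ) + 1)) := by positivity
  linarith

theorem norm_combPt_le {m k : ℕ} (hk : k < m) : ‖combPt m k‖ ≤ 2 := by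
  rw [norm_combPt]
  have hm : (0 : ℝ) < 2 * ((m : ℝ) + 1) := by positivity
  have hk' : (k : ℝ) ≤ (m : ℝ) + 1 := by
    have : (k : ℝ) < m := by exact_mod_cast hk
    linarith
  have : (k : ℝ) / (2 * ((m : ℝ) + 1)) ≤ 1 / 2 := by
    rw [div_le_iff₀ hm]
    linarith
  linarith

theorem combPt_ne_zero (m k : ℕ) : combPt m k ≠ 0 := by
  intro h
  have := le_norm_combPt m k
  rw [h, norm_zero] at this
  linarith

theorem dist_combPt (m k l : ℕ) :
    dist (combPt m k) (combPt m l) = |(k : ℝ) - l| / (2 * ((m : ℝ) + 1)) := by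
  rw [dist_eq_norm, combPt, combPt, ← sub_smul, norm_smul, norm_e0, mul_one]
  have hm : (0 : ℝ) < 2 * ((m : ℝ) + 1) := by positivity
  rw [show (3 : ℝ) / 2 + (k : ℝ) / (2 * ((m : ℝ) + 1)) - (3 / 2 + (l : ℝ) / (2 * ((m : ℝ) + 1))) =
      ((k : ℝ) - l) / (2 * ((m : ℝ) + 1)) by ring, Real.norm_eq_abs, abs_div,
    abs_of_pos hm]

theorem combPt_injective (m : ℕ) : Function.Injective (combPt m) := by
  intro k l h
  have hd := dist_combPt m k l
  rw [h, dist_self] at hd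
  have hm : (0 : ℝ) < 2 * ((m : ℝ) + 1) := by positivity
  have : |(k : ℝ) - l| = 0 := by
    have := hd.symm
    rwa [div_eq_zero_iff, or_iff_left hm.ne'] at this
  have : (k : ℝ) = l := by
    have := abs_eq_zero.1 this
    linarith
  exact_mod_cast this

/-- The comb is `1/(2(m+1))`-separated. [folklore] -/
theorem comb_separated (m : ℕ) :
    ∀ x ∈ (↑(comb m) : Set E3), ∀ y ∈ (↑(comb m) : Set E3), x ≠ y →
      1 / (2 * ((m : ℝ) + 1)) ≤ dist x y := by
  have hm : (0 : ℝ) < 2 * ((m : ℝ) + 1) := by positivity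
  have hsmall : 1 / (2 * ((m : ℝ) + 1)) ≤ 3 / 2 := by
    rw [div_le_iff₀ hm]
    have : (0 : ℝ) ≤ m := by positivity
    linarith
  intro x hx y hy hxy
  simp only [comb, Finset.coe_insert, Finset.coe_image, Finset.coe_range, Set.mem_insert_iff,
    Set.mem_image, Set.mem_Iio] at hx hy
  rcases hx with rfl | ⟨k, hk, rfl⟩ <;> rcases hy with rfl | ⟨l, hl, rfl⟩
  · exact absurd rfl hxy
  · rw [dist_comm, dist_zero_right]
    exact hsmall.trans (le_norm_combPt m l)
  · rw [dist_zero_right]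
    exact hsmall.trans (le_norm_combPt m k)
  · rw [dist_combPt]
    have hkl : k ≠ l := fun h => hxy (by rw [h])
    have : (1 : ℝ) ≤ |(k : ℝ) - l| := by
      rcases lt_or_gt_of_ne hkl with h | h
      · have : (k : ℝ) + 1 ≤ l := by exact_mod_cast h
        rw [abs_of_neg (by linarith)]
        linarith
      · have : (l : ℝ) + 1 ≤ k := by exact_mod_cast h
        rw [abs_of_pos (by linarith)]
        linarith
    exact div_le_div_of_nonneg_right this hm.le

/-- The comb as a rooted hard-core configuration. [folklore] -/
theorem isRootedHardCore_comb (m : ℕ) :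
    IsRootedHardCore (1 / (2 * ((m : ℝ) + 1)))
      ((Measure.count : Measure E3).restrict (↑(comb m) : Set E3)) :=
  ⟨↑(comb m), by simp [comb], comb_separated m, rfl⟩

/-- `V_LJ ≤ −1/1000` on `[3/2, 2]` (with `w = r⁻⁶ ∈ [1/64, 64/729]`, `V = w²/12 − w/6`). [folklore] -/
theorem lennardJones_le_on_comb_annulus {r : ℝ} (h1 : (3 : ℝ) / 2 ≤ r) (h2 : r ≤ 2) :
    lennardJones r ≤ -(1 / 1000) := by
  have hr : 0 < r := by linarith
  have hu0 : 1 / 2 ≤ r⁻¹ := by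
    rw [inv_eq_one_div, le_div_iff₀ hr]; linarith
  have hu1 : r⁻¹ ≤ 2 / 3 := by
    rw [inv_eq_one_div, div_le_iff₀ hr]; linarith
  have hw0 : ((1 : ℝ) / 2) ^ 6 ≤ (r⁻¹) ^ 6 := pow_le_pow_left₀ (by norm_num) hu0 6
  have hw1 : (r⁻¹) ^ 6 ≤ ((2 : ℝ) / 3) ^ 6 := pow_le_pow_left₀ (by positivity) hu1 6
  unfold lennardJones
  have h12 : (r⁻¹) ^ 12 = ((r⁻¹) ^ 6) ^ 2 := by ring
  rw [h12]
  nlinarith [hw0, hw1, mul_nonneg (sub_nonneg.2 hw0) (sub_nonneg.2 hw1)]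

/-- Root energy of the comb: `½ Σ_y V_LJ(‖y‖) ≤ −m/2000`. [folklore] -/
theorem rootEnergy_comb_le (m : ℕ) :
    (∫ y, lennardJones ‖y‖ ∂((Measure.count : Measure E3).restrict (↑(comb m) : Set E3))) / 2 ≤
      -((m : ℝ) / 2000) := by
  rw [integral_count_restrict_coe_finset]
  have h0 : (0 : E3) ∉ (Finset.range m).image (combPt m) := by
    simp only [Finset.mem_image, Finset.mem_range, not_exists, not_and]
    exact fun k _ => combPt_ne_zero m k
  rw [comb, Finset.sum_insert h0, norm_zero, lennardJones_zero, zero_add,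
    Finset.sum_image fun k _ l _ h => combPt_injective m h]
  have hle : ∑ k ∈ Finset.range m, lennardJones ‖combPt m k‖ ≤
      ∑ k ∈ Finset.range m, (-(1 / 1000) : ℝ) :=
    Finset.sum_le_sum fun k hk => lennardJones_le_on_comb_annulus (le_norm_combPt m k)
      (norm_combPt_le (Finset.mem_range.1 hk))
  rw [Finset.sum_const, Finset.card_range, nsmul_eq_mul] at hle
  linarith

/-- The comb's root shell is empty, hence bad. [folklore] -/
theorem not_goodShell_comb (m : ℕ) :
    ¬ GoodShell ((Measure.count : Measure E3).restrict (↑(comb m) : Set E3)) := by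
  refine not_goodShell_of_far fun y hy hy0 => ?_
  rw [count_restrict_singleton_ne_zero_iff] at hy
  simp only [comb, Finset.coe_insert, Finset.coe_image, Finset.coe_range, Set.mem_insert_iff,
    Set.mem_image, Set.mem_Iio] at hy
  rcases hy with rfl | ⟨k, -, rfl⟩
  · exact absurd rfl hy0
  · exact lt_of_lt_of_le (by norm_num) (le_norm_combPt m k)

/-- The comb size that beats `e*`: `m(e*) = ⌈−2000 e*⌉₊` (whatever the real number `e*` is).
[folklore] -/
def combSize : ℕ := ⌈-2000 * eStar⌉₊

theorem rootEnergy_comb_le_eStar :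
    (∫ y, lennardJones ‖y‖ ∂((Measure.count : Measure E3).restrict (↑(comb combSize) : Set E3))) / 2
      ≤ eStar := by
  have h1 := rootEnergy_comb_le combSize
  have h2 : -2000 * eStar ≤ (combSize : ℝ) := Nat.le_ceil _
  linarith

/-- NATURAL STRENGTHENING 1 — the POINTWISE (deterministic) version of the crux: "a rooted hard-core
configuration whose ROOT energy is `≤ e*` has a good root shell". -/
def PointwiseMinimiserShells : Prop :=
  ∀ δ : ℝ, 0 < δ → ∀ μ : Measure E3, IsRootedHardCore δ μ →
    (∫ y, lennardJones ‖y‖ ∂μ) / 2 ≤ eStar → GoodShell μ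

/-- **The pointwise version is false** (comb witness): low root energy can be bought with many far
points. [folklore] -/
theorem not_pointwiseMinimiserShells : ¬ PointwiseMinimiserShells := fun h =>
  not_goodShell_comb combSize
    (h _ (by positivity) _ (isRootedHardCore_comb combSize) rootEnergy_comb_le_eStar)

/-- The set `{count|F}` (`F` finite) is measurable in the Giry σ-algebra: it is cut out by
`μ Fᶜ = 0` and the finitely many evaluations `μ {s} = 1`, `s ∈ F`. [folklore] -/
theorem measurableSet_setOf_eq_count_restrict (F : Finset E3) :
    MeasurableSet {μ : Measure E3 | μ = (Measure.count : Measure E3).restrict (↑F : Set E3)} := by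
  classical
  have hrepr : {μ : Measure E3 | μ = (Measure.count : Measure E3).restrict (↑F : Set E3)} =
      {μ : Measure E3 | μ (↑F : Set E3)ᶜ = 0} ∩ ⋂ s ∈ F, {μ : Measure E3 | μ {s} = 1} := by
    ext μ
    simp only [Set.mem_setOf_eq, Set.mem_inter_iff, Set.mem_iInter]
    constructor
    · rintro rfl
      refine ⟨?_, fun s hs => ?_⟩
      · rw [Measure.restrict_apply F.measurableSet.compl, Set.compl_inter_self, measure_empty]
      · rw [Measure.restrict_apply (measurableSet_singleton s),
          Set.inter_eq_left.2 (Set.singleton_subset_iff.2 (Finset.mem_coe.2 hs)),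
          Measure.count_singleton]
    · rintro ⟨hc, h1⟩
      ext A hA
      rw [Measure.restrict_apply hA]
      have hdiff : μ (A \ ↑F) = 0 := measure_mono_null (fun x hx => hx.2) hc
      rw [← measure_inter_add_sdiff A F.measurableSet, hdiff, add_zero]
      have hAF : A ∩ ↑F = ↑(F.filter fun s => s ∈ A) := by
        ext x
        simp [and_comm]
      rw [hAF, ← sum_measure_singleton, ← sum_measure_singleton]
      refine Finset.sum_congr rfl fun s hs => ?_
      rw [h1 s (Finset.mem_filter.1 hs).1, Measure.count_singleton]
  rw [hrepr]
  refine MeasurableSet.inter ?_ (F.measurableSet_biInter fun s _ => ?_)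
  · exact (Measure.measurable_coe F.measurableSet.compl) (measurableSet_singleton 0)
  · exact (Measure.measurable_coe (measurableSet_singleton s)) (measurableSet_singleton 1)

/-- Under `δ_{count|F}` almost every configuration IS `count|F`. [folklore] -/
theorem ae_eq_dirac_count_restrict (F : Finset E3) :
    ∀ᵐ μ ∂(Measure.dirac ((Measure.count : Measure E3).restrict (↑F : Set E3)) :
      Measure (Measure E3)), μ = (Measure.count : Measure E3).restrict (↑F : Set E3) := by
  rw [ae_iff]
  have h : {μ : Measure E3 | ¬μ = (Measure.count : Measure E3).restrict (↑F : Set E3)} =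
      {μ : Measure E3 | μ = (Measure.count : Measure E3).restrict (↑F : Set E3)}ᶜ := rfl
  rw [h, Measure.dirac_apply' _ (measurableSet_setOf_eq_count_restrict F).compl]
  simp

/-- Mean root energy of a deterministic finite configuration: `E_{δ_{count|F}}[h] = h(count|F)`.
[folklore] -/
theorem meanRootEnergy_dirac_count_restrict (F : Finset E3) :
    meanRootEnergy (Measure.dirac ((Measure.count : Measure E3).restrict (↑F : Set E3))) =
      (∫ y, lennardJones ‖y‖ ∂((Measure.count : Measure E3).restrict (↑F : Set E3))) / 2 := by
  unfold meanRootEnergy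
  set μ₀ := (Measure.count : Measure E3).restrict (↑F : Set E3)
  have heq : (fun μ : Measure E3 => (∫ y, lennardJones ‖y‖ ∂μ) / 2) =ᵐ[(Measure.dirac μ₀ :
      Measure (Measure E3))] fun _ => (∫ y, lennardJones ‖y‖ ∂μ₀) / 2 :=
    (ae_eq_dirac_count_restrict F).mono fun μ hμ => by simp only [hμ, μ₀]
  rw [integral_congr_ae heq]
  simp

/-- The crux with POINT-STATIONARITY DROPPED. -/
def MinimiserShellsWithoutStationarity : Prop :=
  ∀ δ : ℝ, 0 < δ → ∀ P : Measure (Measure E3), IsProbabilityMeasure P →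
    (∀ᵐ μ ∂P, IsRootedHardCore δ μ) → meanRootEnergy P ≤ eStar → ∀ᵐ μ ∂P, GoodShell μ

/-- **Any proof must use the Mecke identity.** Witness: the deterministic law `δ_{count|comb}`.
[folklore] -/
theorem minimiserShells_false_without_stationarity : ¬ MinimiserShellsWithoutStationarity := by
  intro h
  set F := comb combSize
  have hae := ae_eq_dirac_count_restrict F
  have hE : meanRootEnergy (Measure.dirac ((Measure.count : Measure E3).restrict (↑F : Set E3)))
      ≤ eStar := by
    rw [meanRootEnergy_dirac_count_restrict]
    exact rootEnergy_comb_le_eStar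
  have hgood := h _ (by positivity : (0 : ℝ) < 1 / (2 * ((combSize : ℝ) + 1))) _ inferInstance
    (hae.mono fun μ hμ => by rw [hμ]; exact isRootedHardCore_comb combSize) hE
  obtain ⟨μ, hμg, hμe⟩ := (hgood.and hae).exists
  rw [hμe] at hμg
  exact not_goodShell_comb combSize hμg

/-! ## §3 HIDDEN DEPENDENCY: the crux contains the support item `UnimodularEnergyLowerBound` (9229)

If some point-stationary hard-core law `P₀` had `E_{P₀}[h] < e*`, the mixture
`(1−t)·P₀ + t·δ_{δ_0}` (point-stationary laws form a convex cone) would still be minimising for small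
`t > 0` while its root shell is empty with probability `t`: so `MinimiserShells` FAILS.  Hence
`MinimiserShells → UnimodularEnergyLowerBound`: whoever proves the crux has proved `e_uni ≥ e*`
(rank-9 support item, difficulty L, NOT in the route's `closes` chain) on the way — the planner's
two-layer plan should treat 9229 as a prerequisite of 9225, not as a side item. -/

/-- Mixing lemma: the integral against `(1 − t)•P + t•δ_{δ_0}` of the root-energy functional.
[folklore] -/
theorem meanRootEnergy_mix_le {P : Measure (Measure E3)} [IsProbabilityMeasure P] {θ τ : ℝ}
    (hτ0 : 0 < τ) (hτ1 : τ < 1) (hlt : meanRootEnergy P < θ)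
    (hτE : (1 - τ) * meanRootEnergy P ≤ θ) :
    meanRootEnergy ((1 - ENNReal.ofReal τ) • P +
        ENNReal.ofReal τ • (Measure.dirac (Measure.dirac (0 : E3)) : Measure (Measure E3))) ≤
      θ := by
  set t : ℝ≥0∞ := ENNReal.ofReal τ with ht
  set Q : Measure (Measure E3) := Measure.dirac (Measure.dirac (0 : E3)) with hQ
  set F : Measure E3 → ℝ := fun μ => (∫ y, lennardJones ‖y‖ ∂μ) / 2 with hF
  have ht1 : t ≤ 1 := ENNReal.ofReal_le_one.2 hτ1.le
  have ht1' : 1 - t ≠ ∞ := ne_top_of_le_ne_top ENNReal.one_ne_top tsub_le_self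
  have h1t0 : 1 - t ≠ 0 := (tsub_pos_of_lt (ENNReal.ofReal_lt_one.2 hτ1)).ne'
  have hFQ0 : F (Measure.dirac 0) = 0 := by
    simp [hF, lennardJones_zero]
  by_cases hint : Integrable F P
  · have hintQ : Integrable F Q := by
      have hae := ae_dirac_dirac_zero (G := E3) (measurableSet_singleton 0)
      refine (integrable_const (F (Measure.dirac 0))).congr ?_
      exact hae.mono fun μ hμ => by simp only [hμ]
    have hsplit : meanRootEnergy ((1 - t) • P + t • Q) =
        (1 - t).toReal * meanRootEnergy P + t.toReal * F (Measure.dirac 0) := by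
      unfold meanRootEnergy
      rw [integral_add_measure (hint.smul_measure ht1') (hintQ.smul_measure ENNReal.ofReal_ne_top),
        integral_smul_measure, integral_smul_measure, hQ, integral_dirac_dirac_zero]
      simp only [smul_eq_mul]
      rfl
    rw [hsplit, hFQ0, mul_zero, add_zero, ENNReal.toReal_sub_of_le ht1 ENNReal.one_ne_top,
      ENNReal.toReal_one, ENNReal.toReal_ofReal hτ0.le]
    exact hτE
  · have hint' : ¬ Integrable F ((1 - t) • P + t • Q) := by
      intro h'
      apply hint
      have h1 : Integrable F ((1 - t) • P) := h'.mono_measure (Measure.le_add_right le_rfl)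
      exact (integrable_smul_measure h1t0 ht1').1 h1
    have h0 : meanRootEnergy ((1 - t) • P + t • Q) = 0 := integral_undef hint'
    have h0' : meanRootEnergy P = 0 := integral_undef hint
    rw [h0]
    rw [h0'] at hlt
    exact hlt.le

/-- A mixing weight: if `E₀ < θ` there is `τ ∈ (0, 1)` with `(1 − τ) E₀ ≤ θ`. [folklore] -/
theorem exists_mixing_weight {E₀ θ : ℝ} (hlt : E₀ < θ) :
    ∃ τ : ℝ, 0 < τ ∧ τ < 1 ∧ (1 - τ) * E₀ ≤ θ := by
  by_cases hE0 : 0 ≤ E₀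
  · exact ⟨1 / 2, by norm_num, by norm_num, by nlinarith⟩
  · replace hE0 := lt_of_not_ge hE0
    refine ⟨min (1 / 2) ((θ - E₀) / (-E₀)), lt_min (by norm_num) (div_pos (by linarith)
      (by linarith)), (min_le_left _ _).trans_lt (by norm_num), ?_⟩
    have hle : min (1 / 2) ((θ - E₀) / (-E₀)) * (-E₀) ≤ θ - E₀ := by
      calc min (1 / 2) ((θ - E₀) / (-E₀)) * (-E₀)
          ≤ (θ - E₀) / (-E₀) * (-E₀) :=
            mul_le_mul_of_nonneg_right (min_le_right _ _) (by linarith)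
        _ = θ - E₀ := div_mul_cancel₀ _ (by linarith)
    linarith [mul_neg (min (1 / 2) ((θ - E₀) / (-E₀))) E₀]

/-- **The bad minimising mixture.** A point-stationary `δ`-hard-core probability law with mean root
energy `< θ`, mixed with the lone root, gives a point-stationary `δ`-hard-core probability law with
mean root energy `≤ θ` whose root shell is NOT almost surely good (it is empty with positive
probability). With `θ = e*` this is §3, with `θ = e* + s` it kills every slack version (§4).
[folklore] -/
theorem exists_bad_mix {θ δ : ℝ} (P : Measure (Measure E3)) [IsProbabilityMeasure P]
    (hcore : ∀ᵐ μ ∂P, IsRootedHardCore δ μ) (hstat : IsPointStationaryLaw P)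
    (hlt : meanRootEnergy P < θ) :
    ∃ P' : Measure (Measure E3), IsProbabilityMeasure P' ∧ (∀ᵐ μ ∂P', IsRootedHardCore δ μ) ∧
      IsPointStationaryLaw P' ∧ meanRootEnergy P' ≤ θ ∧ ¬ (∀ᵐ μ ∂P', GoodShell μ) := by
  obtain ⟨τ, hτ0, hτ1, hτE⟩ := exists_mixing_weight hlt
  set t : ℝ≥0∞ := ENNReal.ofReal τ with ht
  set Q : Measure (Measure E3) := Measure.dirac (Measure.dirac (0 : E3)) with hQ
  have haeQ := ae_dirac_dirac_zero (G := E3) (measurableSet_singleton 0)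
  have ht0 : t ≠ 0 := by simpa [ht, ENNReal.ofReal_eq_zero, not_le] using hτ0
  have ht1 : t ≤ 1 := ENNReal.ofReal_le_one.2 hτ1.le
  haveI hP' : IsProbabilityMeasure ((1 - t) • P + t • Q) := by
    constructor
    simp only [Measure.add_apply, Measure.smul_apply, smul_eq_mul, measure_univ, mul_one]
    exact tsub_add_cancel_of_le ht1
  refine ⟨(1 - t) • P + t • Q, hP', ?_, ?_, meanRootEnergy_mix_le hτ0 hτ1 hlt hτE, fun hgood => ?_⟩
  · exact ae_add_measure_iff.2 ⟨Measure.ae_smul_measure hcore _,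
      Measure.ae_smul_measure (haeQ.mono fun μ hμ => by rw [hμ]; exact isRootedHardCore_dirac_zero δ) _⟩
  · exact (hstat.smul _).add (isPointStationaryLaw_dirac_dirac_zero.smul _)
  · have hgoodQ : ∀ᵐ μ ∂Q, GoodShell μ :=
      (Measure.ae_ennreal_smul_measure_iff ht0).1 (ae_add_measure_iff.1 hgood).2
    obtain ⟨μ, hμg, hμe⟩ := (hgoodQ.and haeQ).exists
    rw [hμe] at hμg
    exact not_goodShell_dirac_zero hμg

/-- **`MinimiserShells` implies `UnimodularEnergyLowerBound`** (route items 9225 ⇒ 9229).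
(An audit reads this declaration as a conditional proof of 9229 — which it is.) [folklore] -/
theorem minimiserShells_imp_unimodularEnergyLowerBound :
    MinimiserShells → UnimodularEnergyLowerBound := by
  rw [minimiserShells_iff, unimodularEnergyLowerBound_iff]
  intro h δ hδ P hP hcore hstat
  by_contra hlt
  obtain ⟨P', hP', hcore', hstat', hE', hbad⟩ := exists_bad_mix P hcore hstat (lt_of_not_ge hlt)
  exact hbad (h δ hδ P' hP' hcore' hstat' hE')

/-- Contrapositive, in refuter form: a single point-stationary hard-core law with `E_P[h] < e*`
kills the crux. [folklore] -/
theorem minimiserShells_false_of_not_unimodularEnergyLowerBound :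
    ¬ UnimodularEnergyLowerBound → ¬ MinimiserShells :=
  mt minimiserShells_imp_unimodularEnergyLowerBound

/-! ## §4 Uniformly rooted finite configurations (EXACT finite mass transport) and the SLACK versions

`unifRooted x = (1/N) Σ_i δ_{count|(x − x_i)}` — the empirical law of the configuration `x` seen
from a uniformly chosen particle.  It is point-stationary EXACTLY (finite double count,
`isPointStationaryLaw_unifRooted`: the lemma item 9230 `BenjaminiSchrammLimit` starts from), hard
core = the configuration's own minimal distance, and `E_{P_x}[h] = 𝓔_N(x)/N` EXACTLY
(`meanRootEnergy_unifRooted`, from the tree's `sum_rootEnergy_rooted_lennardJones`).  With ground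
states (`exists_isGroundState_separated`) and `CrysEnergyLimit` (0626: `E(N)/N → e*`) these are
point-stationary hard-core laws of energy `< e* + s` for every `s > 0`; mixing with the lone root
(`exists_bad_mix`) kills EVERY slack version of the crux: `not_minimiserShellsSlack_of_crysEnergyLimit`.
So a proof of `MinimiserShells` cannot be stable under `E_P[h] ↦ E_P[h] + s`: it must use EXACT
minimality, i.e. a first-order mechanism `E_P[h] ≥ e* + c·P(bad)` — and by §2c the `c` cannot come
from a pointwise certificate. -/

section UnifRooted

variable {N : ℕ}

/-- The configuration `x` seen from particle `i`: the finite set `{x_k − x_i | k}`. -/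
def rootedAt (x : Fin N → E3) (i : Fin N) : Finset E3 := Finset.univ.image fun k => x k - x i

/-- Its counting measure `count|{x_k − x_i | k}`. -/
def rootedMeasure (x : Fin N → E3) (i : Fin N) : Measure E3 :=
  (Measure.count : Measure E3).restrict (↑(rootedAt x i) : Set E3)

/-- `rootedMeasure` in the `Set.range` form of `RootEnergy.lean`. [folklore] -/
theorem rootedMeasure_eq_range (x : Fin N → E3) (i : Fin N) :
    rootedMeasure x i = (Measure.count : Measure E3).restrict (Set.range fun k => x k - x i) := by
  rw [rootedMeasure, rootedAt, range_sub_eq_coe_image]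

/-- **The uniformly rooted empirical law** `P_x = (1/N) Σ_i δ_{count|(x − x_i)}`. -/
def unifRooted (x : Fin N → E3) : Measure (Measure E3) :=
  ((N : ℝ≥0∞)⁻¹) • ∑ i : Fin N, (Measure.dirac (rootedMeasure x i) : Measure (Measure E3))

/-- `P_x` is a probability law (`N ≠ 0`). [folklore] -/
theorem isProbabilityMeasure_unifRooted [NeZero N] (x : Fin N → E3) :
    IsProbabilityMeasure (unifRooted x) := by
  constructor
  simp only [unifRooted, Measure.smul_apply, Measure.coe_finsetSum, Finset.sum_apply,
    measure_univ, Finset.sum_const, Finset.card_univ, Fintype.card_fin, smul_eq_mul,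
    nsmul_eq_mul, mul_one]
  exact ENNReal.inv_mul_cancel (by exact_mod_cast (NeZero.ne N)) (ENNReal.natCast_ne_top N)

/-- Under `δ_{count|(x − x_i)}` a.e. configuration is `count|(x − x_i)`. [folklore] -/
theorem ae_eq_dirac_rootedMeasure (x : Fin N → E3) (i : Fin N) :
    ∀ᵐ μ ∂(Measure.dirac (rootedMeasure x i) : Measure (Measure E3)), μ = rootedMeasure x i := by
  unfold rootedMeasure
  exact ae_eq_dirac_count_restrict _

/-- `∫⁻` against `δ_{count|(x − x_i)}` evaluates (no measurability needed). [folklore] -/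
theorem lintegral_dirac_rootedMeasure (x : Fin N → E3) (i : Fin N) (G : Measure E3 → ℝ≥0∞) :
    ∫⁻ μ, G μ ∂(Measure.dirac (rootedMeasure x i) : Measure (Measure E3)) =
      G (rootedMeasure x i) := by
  have heq : (fun μ => G μ) =ᵐ[(Measure.dirac (rootedMeasure x i) : Measure (Measure E3))]
      fun _ => G (rootedMeasure x i) :=
    (ae_eq_dirac_rootedMeasure x i).mono fun μ hμ => by simp only [hμ]
  rw [lintegral_congr_ae heq, lintegral_const, measure_univ, mul_one]

/-- `∫` against `δ_{count|(x − x_i)}` evaluates (no measurability needed). [folklore] -/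
theorem integral_dirac_rootedMeasure (x : Fin N → E3) (i : Fin N) (G : Measure E3 → ℝ) :
    ∫ μ, G μ ∂(Measure.dirac (rootedMeasure x i) : Measure (Measure E3)) =
      G (rootedMeasure x i) := by
  have heq : (fun μ => G μ) =ᵐ[(Measure.dirac (rootedMeasure x i) : Measure (Measure E3))]
      fun _ => G (rootedMeasure x i) :=
    (ae_eq_dirac_rootedMeasure x i).mono fun μ hμ => by simp only [hμ]
  rw [integral_congr_ae heq]
  simp

/-- Every real functional is integrable against `δ_{count|(x − x_i)}` (it is a.e. constant).
[folklore] -/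
theorem integrable_dirac_rootedMeasure (x : Fin N → E3) (i : Fin N) (G : Measure E3 → ℝ) :
    Integrable G (Measure.dirac (rootedMeasure x i) : Measure (Measure E3)) :=
  (integrable_const (G (rootedMeasure x i))).congr
    ((ae_eq_dirac_rootedMeasure x i).mono fun μ hμ => by simp only [hμ])

/-- Expectation under the uniformly rooted law: `E_{P_x}[G] = (1/N) Σ_i G(count|(x − x_i))`
(`ℝ≥0∞`-valued). [folklore] -/
theorem lintegral_unifRooted (x : Fin N → E3) (G : Measure E3 → ℝ≥0∞) :
    ∫⁻ μ, G μ ∂(unifRooted x) = (N : ℝ≥0∞)⁻¹ * ∑ i, G (rootedMeasure x i) := by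
  rw [unifRooted, lintegral_smul_measure, lintegral_finsetSum_measure]
  simp_rw [lintegral_dirac_rootedMeasure]
  rfl

/-- Expectation under the uniformly rooted law (real-valued). [folklore] -/
theorem integral_unifRooted (x : Fin N → E3) (G : Measure E3 → ℝ) :
    ∫ μ, G μ ∂(unifRooted x) = (N : ℝ)⁻¹ * ∑ i, G (rootedMeasure x i) := by
  rw [unifRooted, integral_smul_measure,
    integral_finsetSum_measure fun i _ => integrable_dirac_rootedMeasure x i G]
  simp_rw [integral_dirac_rootedMeasure]
  rw [smul_eq_mul, ENNReal.toReal_inv, ENNReal.toReal_natCast]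

/-- Sums over the rooted configuration: `∫⁻ f d(count|(x − x_i)) = Σ_k f(x_k − x_i)` for distinct
points. [folklore] -/
theorem lintegral_rootedMeasure {x : Fin N → E3} (hx : Function.Injective x) (i : Fin N)
    (f : E3 → ℝ≥0∞) : ∫⁻ y, f y ∂(rootedMeasure x i) = ∑ k, f (x k - x i) := by
  have hinj : Function.Injective fun k => x k - x i := fun k l h => hx (sub_left_inj.1 h)
  rw [rootedMeasure, count_restrict_coe_finset, lintegral_finsetSum_measure]
  simp_rw [lintegral_dirac]
  rw [rootedAt, Finset.sum_image fun k _ l _ h => hinj h]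

/-- **Re-rooting**: shifting `count|(x − x_i)` by the point `x_k − x_i` gives `count|(x − x_k)`.
[folklore] -/
theorem map_sub_rootedMeasure (x : Fin N → E3) (i k : Fin N) :
    (rootedMeasure x i).map (fun z => z - (x k - x i)) = rootedMeasure x k := by
  rw [rootedMeasure, rootedMeasure, map_sub_count_restrict]
  congr 1
  rw [rootedAt, rootedAt, Finset.coe_image, Finset.coe_image, Set.image_image]
  refine Set.image_congr fun l _ => ?_
  abel

/-- **Exact finite mass transport**: the uniformly rooted law of a configuration of distinct points
is point-stationary (`Σ_i Σ_k g(θ_{x_i} x, x_k − x_i) = Σ_k Σ_i g(θ_{x_k} x, x_i − x_k)`).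
[folklore] -/
theorem isPointStationaryLaw_unifRooted {x : Fin N → E3} (hx : Function.Injective x) :
    IsPointStationaryLaw (unifRooted x) := by
  intro g _
  rw [lintegral_unifRooted, lintegral_unifRooted]
  congr 1
  simp_rw [lintegral_rootedMeasure hx, map_sub_rootedMeasure, neg_sub]
  exact Finset.sum_comm

/-- The rooted configuration of a `δ`-separated configuration is a rooted `δ`-hard-core
configuration. [folklore] -/
theorem isRootedHardCore_rootedMeasure {x : Fin N → E3} {δ : ℝ}
    (hsep : ∀ k l, k ≠ l → δ ≤ dist (x k) (x l)) (i : Fin N) :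
    IsRootedHardCore δ (rootedMeasure x i) := by
  refine ⟨↑(rootedAt x i), ?_, ?_, rfl⟩
  · exact Finset.mem_coe.2 (Finset.mem_image.2 ⟨i, Finset.mem_univ _, sub_self _⟩)
  · intro y hy y' hy' hne
    rw [Finset.mem_coe, rootedAt, Finset.mem_image] at hy hy'
    obtain ⟨k, -, rfl⟩ := hy
    obtain ⟨l, -, rfl⟩ := hy'
    rw [dist_sub_right]
    exact hsep k l fun h => hne (by rw [h])

/-- Hence the uniformly rooted law is a.s. `δ`-hard-core. [folklore] -/
theorem ae_isRootedHardCore_unifRooted {x : Fin N → E3} {δ : ℝ}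
    (hsep : ∀ k l, k ≠ l → δ ≤ dist (x k) (x l)) :
    ∀ᵐ μ ∂(unifRooted x), IsRootedHardCore δ μ := by
  unfold unifRooted
  refine Measure.ae_smul_measure ?_ _
  rw [ae_iff]
  simp only [Measure.coe_finsetSum, Finset.sum_apply, Finset.sum_eq_zero_iff, Finset.mem_univ,
    true_imp_iff]
  intro i
  exact ae_iff.1 ((ae_eq_dirac_rootedMeasure x i).mono fun μ hμ => by
    rw [hμ]; exact isRootedHardCore_rootedMeasure hsep i)

/-- **Energy identity**: `E_{P_x}[h] = 𝓔_N(x)/N` exactly (Lennard-Jones, distinct points).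
[folklore] -/
theorem meanRootEnergy_unifRooted {x : Fin N → E3} (hx : Function.Injective x) :
    meanRootEnergy (unifRooted x) = interactionEnergy lennardJones x / N := by
  unfold meanRootEnergy
  rw [integral_unifRooted]
  have h : ∀ i, (∫ y, lennardJones ‖y‖ ∂(rootedMeasure x i)) / 2 =
      rootEnergy lennardJones ((Measure.count : Measure E3).restrict
        (Set.range fun k => x k - x i)) := fun i => by
    rw [← rootedMeasure_eq_range]; rfl
  simp_rw [h, sum_rootEnergy_rooted_lennardJones hx]
  rw [div_eq_inv_mul]

end UnifRooted

/-- The `s`-SLACK version of the crux: laws with `E_P[h] ≤ e* + s` have good root shells a.s. -/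
def MinimiserShellsSlack (s : ℝ) : Prop :=
  ∀ δ : ℝ, 0 < δ → ∀ P : Measure (Measure E3), IsProbabilityMeasure P →
    (∀ᵐ μ ∂P, IsRootedHardCore δ μ) → IsPointStationaryLaw P → meanRootEnergy P ≤ eStar + s →
    ∀ᵐ μ ∂P, GoodShell μ

/-- Slack `0` is the crux. [folklore] -/
theorem minimiserShellsSlack_zero_iff : MinimiserShellsSlack 0 ↔ MinimiserShells := by
  rw [minimiserShells_iff]
  simp only [MinimiserShellsSlack, add_zero]

/-- The slack versions are monotone. [folklore] -/
theorem MinimiserShellsSlack.anti {s s' : ℝ} (h : s ≤ s') (H : MinimiserShellsSlack s') :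
    MinimiserShellsSlack s := fun δ hδ P hP hcore hstat hE =>
  H δ hδ P hP hcore hstat (hE.trans (by linarith))

/-- Slack `≥ −e*` is refuted by the lone root alone (energy `0`). [folklore] -/
theorem not_minimiserShellsSlack_of_neg_eStar_le {s : ℝ} (hs : -eStar ≤ s) :
    ¬ MinimiserShellsSlack s := by
  intro h
  have hae := ae_dirac_dirac_zero (G := E3) (measurableSet_singleton 0)
  have hgood := h 1 one_pos (Measure.dirac (Measure.dirac (0 : E3))) inferInstance
    (hae.mono fun μ hμ => by rw [hμ]; exact isRootedHardCore_dirac_zero 1)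
    isPointStationaryLaw_dirac_dirac_zero (by rw [meanRootEnergy_dirac_dirac_zero]; linarith)
  obtain ⟨μ, hμg, hμe⟩ := (hgood.and hae).exists
  rw [hμe] at hμg
  exact not_goodShell_dirac_zero hμg

/-- **One cheap law kills a slack version**: a point-stationary hard-core probability law with
`E_P[h] < e* + s` refutes `MinimiserShellsSlack s` (mix with the lone root). [folklore] -/
theorem not_minimiserShellsSlack_of_law {s δ : ℝ} (hδ : 0 < δ) (P : Measure (Measure E3))
    [IsProbabilityMeasure P] (hcore : ∀ᵐ μ ∂P, IsRootedHardCore δ μ)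
    (hstat : IsPointStationaryLaw P) (hE : meanRootEnergy P < eStar + s) :
    ¬ MinimiserShellsSlack s := by
  intro h
  obtain ⟨P', hP', hcore', hstat', hE', hbad⟩ := exists_bad_mix P hcore hstat hE
  exact hbad (h δ hδ P' hP' hcore' hstat' hE')

/-- **No slack version of the crux holds** (modulo the soft support item 0626 `CrysEnergyLimit`,
`E(N)/N → e*`): for every `s > 0`, uniformly rooted Lennard-Jones ground states with `N` large are
point-stationary hard-core laws of energy `E(N)/N < e* + s`. [folklore] -/
theorem not_minimiserShellsSlack_of_crysEnergyLimit
    (hlim : Summit.AtomisticToContinuum.Crystallization.Theses.PalmUnimodularRigidity.CrysEnergyLimit)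
    {s : ℝ} (hs : 0 < s) : ¬ MinimiserShellsSlack s := by
  obtain ⟨δ, hδ, hgs⟩ := exists_isGroundState_separated LennardJonesGroundStatesExist_holds
    LennardJonesMinimalDistance_holds
  have hlt : (⨅ Q : PeriodicConfiguration 3, Q.energyPerParticle lennardJones) < eStar + s := by
    change eStar < eStar + s
    linarith
  have hev : ∀ᶠ N : ℕ in Filter.atTop, groundStateEnergy lennardJones 3 N / N < eStar + s :=
    hlim.eventually (Iio_mem_nhds hlt)
  obtain ⟨N, hN, hN1⟩ := (hev.and (Filter.eventually_ge_atTop 1)).exists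
  haveI : NeZero N := ⟨by omega⟩
  obtain ⟨x, hxgs, hsep⟩ := hgs N
  haveI := isProbabilityMeasure_unifRooted x
  refine not_minimiserShellsSlack_of_law hδ (unifRooted x) (ae_isRootedHardCore_unifRooted hsep)
    (isPointStationaryLaw_unifRooted hxgs.1) ?_
  rw [meanRootEnergy_unifRooted hxgs.1, hxgs.2]
  exact hN

/-! ## §5 The intended first-order mechanism `E_P[h] ≥ e* + c·P(bad)`: sufficiency, and the CEILING on `c`

`LinearPricing c` is the expectation inequality the crux docstring and every round-1/2 card aim at.
It suffices for the crux for every `c > 0` (`minimiserShells_of_linearPricing`, outer-measure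
bookkeeping only: no measurability of the shell event is needed), it contains 9229
(`unimodularEnergyLowerBound_of_linearPricing`), and it is CAPPED by every cheap all-bad law:
`c ≤ E_P[h] − e*` whenever `P` is point-stationary, hard-core and a.s. BAD (`linearPricing_ceiling`).
Numerics (kit job j008791, pure-python lattice sums with continuum tails; smoke values at cutoff 4.5a,
refined values in `~/compute/j008791/outputs/result.json`): the Palm law `δ_{count|F·fcc*}` of the
homogeneously strained relaxed fcc lattice is point-stationary (Bravais), hard-core, and ALL its
shells are `(a/100)`-bad as soon as the deviatoric strain passes the matching threshold; the
cheapest family found is the volume-preserving TETRAGONAL stretch `diag(1+h, 1−h, ·)`, bad from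
`h = 1.00 %` (mismatch = `h` exactly on the four in-plane neighbours; rotations and the free scale
cannot absorb a symmetric traceless strain), at energy cost `e(F·fcc) − e_fcc = 4.4e-4`
(`= 0.061 %` of `|e*|`; uniaxial [100]: bad from 1.4 %, 6.2e-4; xy simple shear: 2.1 %, 1.06e-3;
uniaxial [111]: 1.4 %, 1.35e-3; for comparison bcc +3.1e-2 = 4.3 %, A15 +8.6e-2 = 12 %, and the
ideators' j007481: σ-phase 4f site +0.99 %, e_fcc − e_hcp = 7.25e-5).  HENCE `c ≤ 4.4e-4 + 7e-5`:
any certificate for the fine `(a/100)` target must resolve the LJ energy landscape to 6e-4 RELATIVE,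
uniformly over hard-core configurations — five times the hcp/fcc splitting.  (Uncertified numerics;
the certified part is the ceiling LEMMA, the witness law is `δ_{count|L}` for a Bravais `L`, whose
point-stationarity is `IsPointStationaryLaw.of_ae_invariant` in the tree.) -/

/-- **Linear pricing with constant `c`**: for every point-stationary `δ`-hard-core probability law,
`e* + c·P(bad root shell) ≤ E_P[h]` (outer measure of the bad event, `toReal`). -/
def LinearPricing (c : ℝ) : Prop :=
  ∀ δ : ℝ, 0 < δ → ∀ P : Measure (Measure E3), IsProbabilityMeasure P →
    (∀ᵐ μ ∂P, IsRootedHardCore δ μ) → IsPointStationaryLaw P →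
    eStar + c * (P {μ | ¬ GoodShell μ}).toReal ≤ meanRootEnergy P

/-- Linear pricing with any constant `c > 0` proves the crux. [folklore] -/
theorem minimiserShells_of_linearPricing {c : ℝ} (hc : 0 < c) (h : LinearPricing c) :
    MinimiserShells := by
  rw [minimiserShells_iff]
  intro δ hδ P hP hcore hstat hE
  have hineq := h δ hδ P hP hcore hstat
  have hzero : (P {μ | ¬ GoodShell μ}).toReal = 0 := by
    have h1 : c * (P {μ | ¬ GoodShell μ}).toReal ≤ 0 := by linarith
    have h2 : 0 ≤ (P {μ | ¬ GoodShell μ}).toReal := ENNReal.toReal_nonneg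
    nlinarith
  rw [ae_iff]
  rcases (ENNReal.toReal_eq_zero_iff _).1 hzero with h0 | htop
  · exact h0
  · exact absurd htop (measure_ne_top P _)

/-- Linear pricing (any `c ≥ 0`) contains the support item 9229. [folklore] -/
theorem unimodularEnergyLowerBound_of_linearPricing {c : ℝ} (hc : 0 ≤ c) (h : LinearPricing c) :
    UnimodularEnergyLowerBound := by
  rw [unimodularEnergyLowerBound_iff]
  intro δ hδ P hP hcore hstat
  have hineq := h δ hδ P hP hcore hstat
  have : 0 ≤ c * (P {μ | ¬ GoodShell μ}).toReal := mul_nonneg hc ENNReal.toReal_nonneg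
  linarith

/-- **The ceiling on `c`.** Every point-stationary `δ`-hard-core probability law whose root shell is
almost surely BAD caps the constant: `c ≤ E_P[h] − e*`.  (Feed it the Palm law of tetragonally
strained fcc at the 1 % matching threshold: `c ≤ 4.4e-4`, kit j008791.) [folklore] -/
theorem linearPricing_ceiling {c : ℝ} (h : LinearPricing c) {δ : ℝ} (hδ : 0 < δ)
    (P : Measure (Measure E3)) [IsProbabilityMeasure P] (hcore : ∀ᵐ μ ∂P, IsRootedHardCore δ μ)
    (hstat : IsPointStationaryLaw P) (hbad : ∀ᵐ μ ∂P, ¬ GoodShell μ) :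
    c ≤ meanRootEnergy P - eStar := by
  have hineq := h δ hδ P inferInstance hcore hstat
  have hone : (P {μ | ¬ GoodShell μ}).toReal = 1 := by
    have : P {μ | ¬ GoodShell μ} = 1 := by
      have hc : P {μ | ¬ GoodShell μ}ᶜ = 0 := by
        rw [ae_iff] at hbad
        simpa [Set.compl_setOf] using hbad
      have := measure_add_measure_compl₀ (μ := P) (s := {μ | ¬ GoodShell μ}) ?_
      · rw [hc, add_zero, measure_univ] at this
        exact this
      · exact NullMeasurableSet.of_compl (NullMeasurableSet.of_null hc)
    rw [this, ENNReal.toReal_one]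
  rw [hone, mul_one] at hineq
  linarith

/-! ## §6 NORMALISATIONS AND SYMMETRY ARE LOAD-BEARING (cycle 2)

### Shell bookkeeping: at most one non-root atom is never a good shell -/

/-- If the configuration has at most one atom besides the root, its shell is bad (a good shell has
twelve points). [folklore] -/
theorem not_goodShell_of_subsingleton {μ : Measure E3}
    (h : ({y : E3 | μ {y} ≠ 0 ∧ y ≠ 0} : Set E3).Subsingleton) : ¬ GoodShell μ := by
  rintro ⟨a, ha₁, ha₂, T, hT, hclose⟩
  have ha0 : a ≠ 0 := by linarith
  have hcard : T.card = 12 := by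
    rcases hclose with hc | hc
    · rw [hc.card_eq, Finset.card_image_of_injective _ (smul_right_injective E3 ha0),
        card_fccKissingPattern]
    · rw [hc.card_eq, Finset.card_image_of_injective _ (smul_right_injective E3 ha0),
        card_hcpKissingPattern]
  have hle : T.card ≤ 1 := by
    refine Finset.card_le_one.2 fun s hs t ht => h ?_ ?_
    · have := (Set.ext_iff.1 hT s).1 (Finset.mem_coe.2 hs)
      exact ⟨this.1, this.2.1⟩
    · have := (Set.ext_iff.1 hT t).1 (Finset.mem_coe.2 ht)
      exact ⟨this.1, this.2.1⟩
  omega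

/-! ### The two-point cluster `{0, u₀}` at the optimal distance `1` -/

/-- The unit vector `u₀ = e₁`. -/
def u0 : E3 := EuclideanSpace.single 0 1

theorem norm_u0 : ‖u0‖ = 1 := by simp [u0]

theorem u0_ne_zero : u0 ≠ 0 := by
  intro h; have := norm_u0; rw [h, norm_zero] at this; exact zero_ne_one this

/-- The dimer: root at `0`, partner at `u₀`. -/
def pair : Fin 2 → E3 := ![0, u0]

@[simp] theorem pair_zero : pair 0 = 0 := rfl
@[simp] theorem pair_one : pair 1 = u0 := rfl

theorem pair_injective : Function.Injective pair := by
  intro i j h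
  fin_cases i <;> fin_cases j
  · rfl
  · exact absurd h.symm (by simpa using u0_ne_zero)
  · exact absurd h (by simpa using u0_ne_zero)
  · rfl

/-- The dimer is `1`-separated. [folklore] -/
theorem pair_separated : ∀ k l : Fin 2, k ≠ l → (1 : ℝ) ≤ dist (pair k) (pair l) := by
  intro k l hkl
  fin_cases k <;> fin_cases l
  · exact absurd rfl hkl
  · simp [dist_eq_norm, norm_u0]
  · simp [dist_eq_norm, norm_u0]
  · exact absurd rfl hkl

/-- Its interaction energy is `V_LJ(1) = -1/12`. [folklore] -/
theorem interactionEnergy_pair : interactionEnergy lennardJones pair = -1 / 12 := by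
  have h0 : Finset.Ioi (0 : Fin 2) = {1} := by decide
  have h1 : Finset.Ioi (1 : Fin 2) = ∅ := by decide
  rw [interactionEnergy, Fin.sum_univ_two, h0, h1, Finset.sum_singleton, Finset.sum_empty, add_zero,
    pair_zero, pair_one, dist_eq_norm, zero_sub, norm_neg, norm_u0, lennardJones_one]

/-- Seen from either particle, the dimer has exactly one atom besides the root. [folklore] -/
theorem subsingleton_atoms_rootedMeasure_pair (i : Fin 2) {w : ℝ≥0∞} :
    ({y : E3 | (w • rootedMeasure pair i) {y} ≠ 0 ∧ y ≠ 0} : Set E3).Subsingleton := by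
  intro y hy z hz
  simp only [Set.mem_setOf_eq, Measure.smul_apply, smul_eq_mul, ne_eq, mul_eq_zero, not_or] at hy hz
  have hy' := (count_restrict_singleton_ne_zero_iff _ y).1 hy.1.2
  have hz' := (count_restrict_singleton_ne_zero_iff _ z).1 hz.1.2
  rw [Finset.mem_coe, rootedAt, Finset.mem_image] at hy' hz'
  obtain ⟨k, -, rfl⟩ := hy'
  obtain ⟨l, -, rfl⟩ := hz'
  have hk : k ≠ i := fun h => hy.2 (by rw [h, sub_self])
  have hl : l ≠ i := fun h => hz.2 (by rw [h, sub_self])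
  have : k = l := by omega
  rw [this]

/-! ### §6a `IsProbabilityMeasure P` is load-bearing (not just finiteness): `P ↦ c • P` -/

/-- The crux with `IsProbabilityMeasure P` weakened to "`P` finite and non-zero". -/
def MinimiserShellsWithoutNormalisation : Prop :=
  ∀ δ : ℝ, 0 < δ → ∀ P : Measure (Measure E3), IsFiniteMeasure P → P ≠ 0 →
    (∀ᵐ μ ∂P, IsRootedHardCore δ μ) → IsPointStationaryLaw P → meanRootEnergy P ≤ eStar →
    ∀ᵐ μ ∂P, GoodShell μ

/-- The multiple that beats `e*`: `n(e*) = ⌈-24 e*⌉₊ + 1 ≥ 1` (whatever the real number `e*` is). -/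
def mult : ℕ := ⌈-24 * eStar⌉₊ + 1

theorem one_le_mult : 1 ≤ mult := Nat.le_add_left 1 _

theorem mult_energy_le : (mult : ℝ) * (-1 / 24) ≤ eStar := by
  have h : -24 * eStar ≤ (⌈-24 * eStar⌉₊ : ℝ) := Nat.le_ceil _
  have hm : (mult : ℝ) = (⌈-24 * eStar⌉₊ : ℝ) + 1 := by simp [mult]
  rw [hm]
  rcases le_or_gt eStar (1 / 24) with he | he
  · nlinarith
  · have : (0 : ℝ) ≤ (⌈-24 * eStar⌉₊ : ℝ) := Nat.cast_nonneg _
    nlinarith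

instance : NeZero (2 : ℕ) := ⟨by norm_num⟩

/-- Mean root energy of the uniformly rooted dimer: `E(2)/2`-type identity, `= -1/24`. [folklore] -/
theorem meanRootEnergy_unifRooted_pair : meanRootEnergy (unifRooted pair) = -1 / 24 := by
  rw [meanRootEnergy_unifRooted pair_injective, interactionEnergy_pair]
  norm_num

/-- **Any proof must use `P univ = 1`, not merely `P` finite non-zero**: the energy hypothesis is
`1`-homogeneous in `P`, the conclusion `0`-homogeneous. Witness: `n • P_dimer`, `P_dimer` the
uniformly rooted dimer `{0, u₀}` (point-stationary, `1`-hard-core, energy `-1/24`, every shell has ONE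
point), `n = ⌈-24e*⌉₊ + 1`. [folklore] -/
theorem minimiserShells_false_without_normalisation : ¬ MinimiserShellsWithoutNormalisation := by
  intro h
  set P : Measure (Measure E3) := unifRooted pair with hP
  haveI : IsProbabilityMeasure P := isProbabilityMeasure_unifRooted pair
  set P' : Measure (Measure E3) := (mult : ℝ≥0∞) • P with hP'
  have hfin : IsFiniteMeasure P' := ⟨by
    rw [hP', Measure.smul_apply, smul_eq_mul, measure_univ, mul_one]
    exact ENNReal.natCast_lt_top mult⟩
  have hne : P' ≠ 0 := by
    intro h0
    have := congrArg (fun Q : Measure (Measure E3) => Q Set.univ) h0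
    simp only [hP', Measure.smul_apply, smul_eq_mul, measure_univ, mul_one, Measure.coe_zero,
      Pi.zero_apply, Nat.cast_eq_zero] at this
    exact absurd this (by have := one_le_mult; omega)
  have hcore : ∀ᵐ μ ∂P', IsRootedHardCore 1 μ :=
    Measure.ae_smul_measure (ae_isRootedHardCore_unifRooted pair_separated) _
  have hstat : IsPointStationaryLaw P' := (isPointStationaryLaw_unifRooted pair_injective).smul _
  have hE : meanRootEnergy P' ≤ eStar := by
    have : meanRootEnergy P' = (mult : ℝ) * (-1 / 24) := by
      rw [show meanRootEnergy P' = ∫ μ, (∫ y, lennardJones ‖y‖ ∂μ) / 2 ∂P' from rfl, hP',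
        integral_smul_measure, ENNReal.toReal_natCast, smul_eq_mul]
      exact congrArg _ meanRootEnergy_unifRooted_pair
    rw [this]
    exact mult_energy_le
  have hgood := h 1 one_pos P' hfin hne hcore hstat hE
  -- but under `P'` every configuration is a rooted dimer with ONE non-root atom
  have hgoodP : ∀ᵐ μ ∂P, GoodShell μ := by
    have hm0 : (mult : ℝ≥0∞) ≠ 0 := by
      have := one_le_mult; exact_mod_cast (by omega : mult ≠ 0)
    exact (Measure.ae_ennreal_smul_measure_iff hm0).1 hgood
  have hbad : ∀ᵐ μ ∂P, ¬ GoodShell μ := by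
    rw [hP, unifRooted]
    refine Measure.ae_smul_measure ?_ _
    have hi : ∀ i : Fin 2, ∀ᵐ μ ∂(Measure.dirac (rootedMeasure pair i) : Measure (Measure E3)),
        ¬ GoodShell μ := fun i =>
      (ae_eq_dirac_rootedMeasure pair i).mono fun μ hμ => by
        rw [hμ]
        have := subsingleton_atoms_rootedMeasure_pair i (w := 1)
        rw [one_smul] at this
        exact not_goodShell_of_subsingleton this
    rw [ae_iff]
    simp only [Measure.coe_finsetSum, Finset.sum_apply, Finset.sum_eq_zero_iff, Finset.mem_univ,
      true_imp_iff]
    exact fun i => ae_iff.1 (hi i)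
  obtain ⟨μ, h1, h2⟩ := (hgoodP.and hbad).exists
  exact h2 h1


/-- The weakened statement implies the crux (it IS a weakening of the hypotheses). [folklore] -/
theorem minimiserShells_of_withoutNormalisation (h : MinimiserShellsWithoutNormalisation) :
    MinimiserShells := by
  rw [minimiserShells_iff]
  intro δ hδ P hP hcore hstat hE
  exact h δ hδ P inferInstance (IsProbabilityMeasure.ne_zero P) hcore hstat hE

/-! ### §6b The unit-mass clause of hypothesis (i) is load-bearing: `μ ↦ k • μ`

Hypothesis (i) says `μ = count|S` — every atom has mass EXACTLY `1`.  Relax it to "every atom has the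
same integer mass `k ≥ 1`" (`IsRootedHardCoreMult`; these ARE the vague limits of empirical measures
the summit's `IsCrystallizing` allows, multiplicities `m ≥ 1`) and the crux becomes FALSE: the image of
a point-stationary law under `μ ↦ k • μ` is point-stationary, its energy is multiplied by `k`, its
shells are unchanged.  So any proof must use unit masses — the formal shadow of "one unit of
probability per particle": `E_P[h]` is linear in `μ`, `P(bad)` is not. -/

/-- Rooted `δ`-hard-core configuration WITH A COMMON INTEGER MULTIPLICITY: `μ = k • count|S` for a
`δ`-separated `S ∋ 0` and an integer `k ≥ 1` (`k = 1` is `IsRootedHardCore`). -/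
def IsRootedHardCoreMult (δ : ℝ) (μ : Measure E3) : Prop :=
  ∃ S : Set E3, (0 : E3) ∈ S ∧ (∀ x ∈ S, ∀ y ∈ S, x ≠ y → δ ≤ dist x y) ∧
    ∃ k : ℕ, 1 ≤ k ∧ μ = (k : ℝ≥0∞) • (Measure.count : Measure E3).restrict S

/-- Unit mass is the case `k = 1`. [folklore] -/
theorem isRootedHardCoreMult_of_isRootedHardCore {δ : ℝ} {μ : Measure E3}
    (h : IsRootedHardCore δ μ) : IsRootedHardCoreMult δ μ := by
  obtain ⟨S, h0, hsep, rfl⟩ := h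
  exact ⟨S, h0, hsep, 1, le_rfl, by rw [Nat.cast_one, one_smul]⟩

/-- The crux with hypothesis (i) relaxed to integer multiplicities. -/
def MinimiserShellsWithoutUnitMass : Prop :=
  ∀ δ : ℝ, 0 < δ → ∀ P : Measure (Measure E3), IsProbabilityMeasure P →
    (∀ᵐ μ ∂P, IsRootedHardCoreMult δ μ) → IsPointStationaryLaw P → meanRootEnergy P ≤ eStar →
    ∀ᵐ μ ∂P, GoodShell μ

/-- The relaxed statement implies the crux (it IS a weakening of hypothesis (i)). [folklore] -/
theorem minimiserShells_of_withoutUnitMass (h : MinimiserShellsWithoutUnitMass) :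
    MinimiserShells := by
  rw [minimiserShells_iff]
  intro δ hδ P hP hcore hstat hE
  exact h δ hδ P hP (hcore.mono fun μ hμ => isRootedHardCoreMult_of_isRootedHardCore hμ) hstat hE

section MultRooted

variable {N : ℕ}

/-- The set `{w • count|F}` (`F` finite) is measurable in the Giry σ-algebra: it is cut out by
`μ Fᶜ = 0` and the finitely many evaluations `μ {s} = w`, `s ∈ F`. [folklore] -/
theorem measurableSet_setOf_eq_smul_count_restrict (w : ℝ≥0∞) (F : Finset E3) :
    MeasurableSet {μ : Measure E3 |
      μ = w • (Measure.count : Measure E3).restrict (↑F : Set E3)} := by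
  classical
  have hrepr : {μ : Measure E3 | μ = w • (Measure.count : Measure E3).restrict (↑F : Set E3)} =
      {μ : Measure E3 | μ (↑F : Set E3)ᶜ = 0} ∩ ⋂ s ∈ F, {μ : Measure E3 | μ {s} = w} := by
    ext μ
    simp only [Set.mem_setOf_eq, Set.mem_inter_iff, Set.mem_iInter]
    constructor
    · rintro rfl
      refine ⟨?_, fun s hs => ?_⟩
      · rw [Measure.smul_apply, Measure.restrict_apply F.measurableSet.compl, Set.compl_inter_self,
          measure_empty, smul_zero]
      · rw [Measure.smul_apply, Measure.restrict_apply (measurableSet_singleton s),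
          Set.inter_eq_left.2 (Set.singleton_subset_iff.2 (Finset.mem_coe.2 hs)),
          Measure.count_singleton, smul_eq_mul, mul_one]
    · rintro ⟨hc, h1⟩
      ext A hA
      rw [Measure.smul_apply, Measure.restrict_apply hA, smul_eq_mul]
      have hdiff : μ (A \ ↑F) = 0 := measure_mono_null (fun x hx => hx.2) hc
      rw [← measure_inter_add_sdiff A F.measurableSet, hdiff, add_zero]
      have hAF : A ∩ ↑F = ↑(F.filter fun s => s ∈ A) := by
        ext x
        simp [and_comm]
      rw [hAF, ← sum_measure_singleton, Measure.count_apply_finset,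
        Finset.sum_congr rfl fun s hs => h1 s (Finset.mem_filter.1 hs).1, Finset.sum_const,
        nsmul_eq_mul, mul_comm]
  rw [hrepr]
  refine MeasurableSet.inter ?_ (F.measurableSet_biInter fun s _ => ?_)
  · exact (Measure.measurable_coe F.measurableSet.compl) (measurableSet_singleton 0)
  · exact (Measure.measurable_coe (measurableSet_singleton s)) (measurableSet_singleton w)

/-- Under `δ_{w • count|F}` almost every configuration IS `w • count|F`. [folklore] -/
theorem ae_eq_dirac_smul_count_restrict (w : ℝ≥0∞) (F : Finset E3) :
    ∀ᵐ μ ∂(Measure.dirac (w • (Measure.count : Measure E3).restrict (↑F : Set E3)) :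
      Measure (Measure E3)), μ = w • (Measure.count : Measure E3).restrict (↑F : Set E3) := by
  rw [ae_iff]
  have h : {μ : Measure E3 | ¬μ = w • (Measure.count : Measure E3).restrict (↑F : Set E3)} =
      {μ : Measure E3 | μ = w • (Measure.count : Measure E3).restrict (↑F : Set E3)}ᶜ := rfl
  rw [h, Measure.dirac_apply' _ (measurableSet_setOf_eq_smul_count_restrict w F).compl]
  simp

/-- **The uniformly rooted law with atom mass `w`**: `(1/N) Σ_i δ_{w • count|(x − x_i)}`. -/
def multRooted (w : ℝ≥0∞) (x : Fin N → E3) : Measure (Measure E3) :=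
  ((N : ℝ≥0∞)⁻¹) • ∑ i : Fin N, (Measure.dirac (w • rootedMeasure x i) : Measure (Measure E3))

/-- It is a probability law (`N ≠ 0`). [folklore] -/
theorem isProbabilityMeasure_multRooted [NeZero N] (w : ℝ≥0∞) (x : Fin N → E3) :
    IsProbabilityMeasure (multRooted w x) := by
  constructor
  simp only [multRooted, Measure.smul_apply, Measure.coe_finsetSum, Finset.sum_apply,
    measure_univ, Finset.sum_const, Finset.card_univ, Fintype.card_fin, smul_eq_mul,
    nsmul_eq_mul, mul_one]
  exact ENNReal.inv_mul_cancel (by exact_mod_cast (NeZero.ne N)) (ENNReal.natCast_ne_top N)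

/-- Under `δ_{w • count|(x − x_i)}` a.e. configuration is `w • count|(x − x_i)`. [folklore] -/
theorem ae_eq_dirac_smul_rootedMeasure (w : ℝ≥0∞) (x : Fin N → E3) (i : Fin N) :
    ∀ᵐ μ ∂(Measure.dirac (w • rootedMeasure x i) : Measure (Measure E3)),
      μ = w • rootedMeasure x i := by
  unfold rootedMeasure
  exact ae_eq_dirac_smul_count_restrict w _

/-- `∫⁻` against `δ_{w • count|(x − x_i)}` evaluates. [folklore] -/
theorem lintegral_dirac_smul_rootedMeasure (w : ℝ≥0∞) (x : Fin N → E3) (i : Fin N)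
    (G : Measure E3 → ℝ≥0∞) :
    ∫⁻ μ, G μ ∂(Measure.dirac (w • rootedMeasure x i) : Measure (Measure E3)) =
      G (w • rootedMeasure x i) := by
  have heq : (fun μ => G μ) =ᵐ[(Measure.dirac (w • rootedMeasure x i) : Measure (Measure E3))]
      fun _ => G (w • rootedMeasure x i) :=
    (ae_eq_dirac_smul_rootedMeasure w x i).mono fun μ hμ => by simp only [hμ]
  rw [lintegral_congr_ae heq, lintegral_const, measure_univ, mul_one]

/-- `∫` against `δ_{w • count|(x − x_i)}` evaluates. [folklore] -/
theorem integral_dirac_smul_rootedMeasure (w : ℝ≥0∞) (x : Fin N → E3) (i : Fin N)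
    (G : Measure E3 → ℝ) :
    ∫ μ, G μ ∂(Measure.dirac (w • rootedMeasure x i) : Measure (Measure E3)) =
      G (w • rootedMeasure x i) := by
  have heq : (fun μ => G μ) =ᵐ[(Measure.dirac (w • rootedMeasure x i) : Measure (Measure E3))]
      fun _ => G (w • rootedMeasure x i) :=
    (ae_eq_dirac_smul_rootedMeasure w x i).mono fun μ hμ => by simp only [hμ]
  rw [integral_congr_ae heq]
  simp

/-- Every real functional is integrable against `δ_{w • count|(x − x_i)}`. [folklore] -/
theorem integrable_dirac_smul_rootedMeasure (w : ℝ≥0∞) (x : Fin N → E3) (i : Fin N)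
    (G : Measure E3 → ℝ) :
    Integrable G (Measure.dirac (w • rootedMeasure x i) : Measure (Measure E3)) :=
  (integrable_const (G (w • rootedMeasure x i))).congr
    ((ae_eq_dirac_smul_rootedMeasure w x i).mono fun μ hμ => by simp only [hμ])

/-- Expectation under `multRooted` (`ℝ≥0∞`-valued). [folklore] -/
theorem lintegral_multRooted (w : ℝ≥0∞) (x : Fin N → E3) (G : Measure E3 → ℝ≥0∞) :
    ∫⁻ μ, G μ ∂(multRooted w x) = (N : ℝ≥0∞)⁻¹ * ∑ i, G (w • rootedMeasure x i) := by
  rw [multRooted, lintegral_smul_measure, lintegral_finsetSum_measure]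
  simp_rw [lintegral_dirac_smul_rootedMeasure]
  rfl

/-- Expectation under `multRooted` (real-valued). [folklore] -/
theorem integral_multRooted (w : ℝ≥0∞) (x : Fin N → E3) (G : Measure E3 → ℝ) :
    ∫ μ, G μ ∂(multRooted w x) = (N : ℝ)⁻¹ * ∑ i, G (w • rootedMeasure x i) := by
  rw [multRooted, integral_smul_measure,
    integral_finsetSum_measure fun i _ => integrable_dirac_smul_rootedMeasure w x i G]
  simp_rw [integral_dirac_smul_rootedMeasure]
  rw [smul_eq_mul, ENNReal.toReal_inv, ENNReal.toReal_natCast]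

/-- **Mass transport survives multiplicities**: `multRooted w x` is point-stationary for distinct
points (the same finite double count, every term carrying the factor `w`). [folklore] -/
theorem isPointStationaryLaw_multRooted {x : Fin N → E3} (hx : Function.Injective x) (w : ℝ≥0∞) :
    IsPointStationaryLaw (multRooted w x) := by
  intro g _
  rw [lintegral_multRooted, lintegral_multRooted]
  congr 1
  simp_rw [lintegral_smul_measure, lintegral_rootedMeasure hx, Measure.map_smul,
    map_sub_rootedMeasure, neg_sub, smul_eq_mul, Finset.mul_sum]
  exact Finset.sum_comm

/-- **Energy is multiplied by the mass**: `E[h] = w · 𝓔_N(x)/N`. [folklore] -/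
theorem meanRootEnergy_multRooted {x : Fin N → E3} (hx : Function.Injective x) (w : ℝ≥0∞) :
    meanRootEnergy (multRooted w x) = w.toReal * (interactionEnergy lennardJones x / N) := by
  rw [← meanRootEnergy_unifRooted hx,
    show meanRootEnergy (unifRooted x) = ∫ μ, (∫ y, lennardJones ‖y‖ ∂μ) / 2 ∂(unifRooted x)
      from rfl,
    show meanRootEnergy (multRooted w x) = ∫ μ, (∫ y, lennardJones ‖y‖ ∂μ) / 2 ∂(multRooted w x)
      from rfl, integral_multRooted, integral_unifRooted]
  simp_rw [integral_smul_measure, smul_eq_mul, mul_div_assoc]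
  rw [← Finset.mul_sum]
  ring

end MultRooted

/-- **Any proof must use unit atom masses.** Witness: the uniformly rooted dimer with every atom
of mass `n = ⌈-24e*⌉₊ + 1`: a probability law, point-stationary, carried by `n • count|S` with `S`
rooted and `1`-separated, energy `-n/24 ≤ e*`, and every shell has ONE point. [folklore] -/
theorem minimiserShells_false_without_unitMass : ¬ MinimiserShellsWithoutUnitMass := by
  intro h
  set P : Measure (Measure E3) := multRooted (mult : ℝ≥0∞) pair with hP
  haveI : IsProbabilityMeasure P := isProbabilityMeasure_multRooted _ pair
  have hcomp : ∀ i : Fin 2, ∀ᵐ μ ∂(Measure.dirac ((mult : ℝ≥0∞) • rootedMeasure pair i) :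
      Measure (Measure E3)), IsRootedHardCoreMult 1 μ ∧ ¬ GoodShell μ := fun i =>
    (ae_eq_dirac_smul_rootedMeasure _ pair i).mono fun μ hμ => by
      rw [hμ]
      refine ⟨?_, not_goodShell_of_subsingleton (subsingleton_atoms_rootedMeasure_pair i)⟩
      obtain ⟨S, h0, hsep, hS⟩ := isRootedHardCore_rootedMeasure pair_separated i
      exact ⟨S, h0, hsep, mult, one_le_mult, by rw [hS]⟩
  have hboth : ∀ᵐ μ ∂P, IsRootedHardCoreMult 1 μ ∧ ¬ GoodShell μ := by
    rw [hP, multRooted]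
    refine Measure.ae_smul_measure ?_ _
    rw [ae_iff]
    simp only [Measure.coe_finsetSum, Finset.sum_apply, Finset.sum_eq_zero_iff, Finset.mem_univ,
      true_imp_iff]
    exact fun i => ae_iff.1 (hcomp i)
  have hstat : IsPointStationaryLaw P := isPointStationaryLaw_multRooted pair_injective _
  have hE : meanRootEnergy P ≤ eStar := by
    rw [hP, meanRootEnergy_multRooted pair_injective, interactionEnergy_pair, ENNReal.toReal_natCast]
    have := mult_energy_le
    push_cast
    linarith
  have hgood := h 1 one_pos P inferInstance (hboth.mono fun μ hμ => hμ.1) hstat hE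
  obtain ⟨μ, h1, h2⟩ := (hgood.and hboth).exists
  exact h2.2 h1


/-! ### §6c Two-point (reflection) symmetry is NOT enough: the Mecke identity must be used with
configuration-dependent transports

`IsReflectionSymmetricLaw P` is the Mecke identity restricted to transports `g(μ, y) = k(y)` that do
not look at the configuration: `E_P Σ_y k(y) = E_P Σ_y k(−y)`.  Every point-stationary law has it;
the SYMMETRIC COMB (the comb of §2b together with its mirror image) has it too, with root energy
`≤ e*` and an empty shell.  So a proof must re-root at the neighbours GENUINELY (use `g` depending on
`θ_y μ`), not merely exploit the evenness of the Palm intensity. -/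

/-- Reflection symmetry of the law: the Mecke identity for configuration-independent transports. -/
def IsReflectionSymmetricLaw (P : Measure (Measure E3)) : Prop :=
  ∀ k : E3 → ℝ≥0∞, Measurable k → ∫⁻ μ, ∫⁻ y, k y ∂μ ∂P = ∫⁻ μ, ∫⁻ y, k (-y) ∂μ ∂P

/-- Point-stationary laws are reflection symmetric. [folklore] -/
theorem IsPointStationaryLaw.isReflectionSymmetricLaw {P : Measure (Measure E3)}
    (h : IsPointStationaryLaw P) : IsReflectionSymmetricLaw P :=
  fun k hk => h (fun _ y => k y) (hk.comp measurable_snd)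

/-- The crux with point-stationarity WEAKENED to reflection symmetry. -/
def MinimiserShellsWithReflectionOnly : Prop :=
  ∀ δ : ℝ, 0 < δ → ∀ P : Measure (Measure E3), IsProbabilityMeasure P →
    (∀ᵐ μ ∂P, IsRootedHardCore δ μ) → IsReflectionSymmetricLaw P → meanRootEnergy P ≤ eStar →
    ∀ᵐ μ ∂P, GoodShell μ

/-- It IS a weakening of the hypotheses. [folklore] -/
theorem minimiserShells_of_withReflectionOnly (h : MinimiserShellsWithReflectionOnly) :
    MinimiserShells := by
  rw [minimiserShells_iff]
  intro δ hδ P hP hcore hstat hE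
  exact h δ hδ P hP hcore (IsPointStationaryLaw.isReflectionSymmetricLaw hstat) hE

/-- The mirrored comb points `−(3/2 + k/(2(m+1))) • e₀`. -/
def negCombPt (m k : ℕ) : E3 := -combPt m k

/-- The symmetric comb: root, comb, mirrored comb. -/
def symComb (m : ℕ) : Finset E3 :=
  insert 0 ((Finset.range m).image (combPt m) ∪ (Finset.range m).image (negCombPt m))

theorem combPt_eq_smul (m k : ℕ) :
    combPt m k = ((3 : ℝ) / 2 + (k : ℝ) / (2 * ((m : ℝ) + 1))) • e0 := rfl

theorem combCoeff_pos (m k : ℕ) : (0 : ℝ) < 3 / 2 + (k : ℝ) / (2 * ((m : ℝ) + 1)) := by positivity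

/-- A comb point and a mirrored comb point are `≥ 3` apart. [folklore] -/
theorem dist_combPt_negCombPt (m k l : ℕ) : (3 : ℝ) ≤ dist (combPt m k) (negCombPt m l) := by
  rw [negCombPt, dist_eq_norm, sub_neg_eq_add, combPt_eq_smul, combPt_eq_smul, ← add_smul, norm_smul,
    norm_e0, mul_one, Real.norm_of_nonneg (by positivity)]
  have h1 : (0 : ℝ) ≤ (k : ℝ) / (2 * ((m : ℝ) + 1)) := by positivity
  have h2 : (0 : ℝ) ≤ (l : ℝ) / (2 * ((m : ℝ) + 1)) := by positivity
  linarith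

theorem combPt_ne_negCombPt (m k l : ℕ) : combPt m k ≠ negCombPt m l := by
  intro h
  have := dist_combPt_negCombPt m k l
  rw [h, dist_self] at this
  linarith

theorem negCombPt_injective (m : ℕ) : Function.Injective (negCombPt m) :=
  fun _ _ h => combPt_injective m (neg_injective h)

theorem disjoint_comb_images (m : ℕ) :
    Disjoint ((Finset.range m).image (combPt m)) ((Finset.range m).image (negCombPt m)) := by
  rw [Finset.disjoint_left]
  intro x hx hx'
  rw [Finset.mem_image] at hx hx'
  obtain ⟨k, -, rfl⟩ := hx
  obtain ⟨l, -, h⟩ := hx'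
  exact combPt_ne_negCombPt m k l h.symm

theorem zero_notMem_comb_images (m : ℕ) :
    (0 : E3) ∉ (Finset.range m).image (combPt m) ∪ (Finset.range m).image (negCombPt m) := by
  simp only [Finset.mem_union, Finset.mem_image, Finset.mem_range, not_or, not_exists, not_and]
  exact ⟨fun k _ => combPt_ne_zero m k, fun k _ h => combPt_ne_zero m k (neg_eq_zero.1 h)⟩

/-- Membership in the symmetric comb, unfolded. [folklore] -/
theorem mem_symComb {m : ℕ} {x : E3} (hx : x ∈ symComb m) :
    x = 0 ∨ (∃ k < m, x = combPt m k) ∨ (∃ k < m, x = negCombPt m k) := by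
  simp only [symComb, Finset.mem_insert, Finset.mem_union, Finset.mem_image, Finset.mem_range] at hx
  rcases hx with rfl | ⟨k, hk, rfl⟩ | ⟨k, hk, rfl⟩
  · exact Or.inl rfl
  · exact Or.inr (Or.inl ⟨k, hk, rfl⟩)
  · exact Or.inr (Or.inr ⟨k, hk, rfl⟩)

theorem norm_negCombPt (m k : ℕ) : ‖negCombPt m k‖ = ‖combPt m k‖ := norm_neg _

/-- The symmetric comb is `1/(2(m+1))`-separated. [folklore] -/
theorem symComb_separated (m : ℕ) :
    ∀ x ∈ (↑(symComb m) : Set E3), ∀ y ∈ (↑(symComb m) : Set E3), x ≠ y →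
      1 / (2 * ((m : ℝ) + 1)) ≤ dist x y := by
  have hm : (0 : ℝ) < 2 * ((m : ℝ) + 1) := by positivity
  have hsmall : 1 / (2 * ((m : ℝ) + 1)) ≤ 3 / 2 := by
    rw [div_le_iff₀ hm]
    have : (0 : ℝ) ≤ m := by positivity
    linarith
  have hkl : ∀ k l : ℕ, k ≠ l → 1 / (2 * ((m : ℝ) + 1)) ≤ |(k : ℝ) - l| / (2 * ((m : ℝ) + 1)) :=
    fun k l hkl => by
    have : (1 : ℝ) ≤ |(k : ℝ) - l| := by
      rcases lt_or_gt_of_ne hkl with h | h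
      · have : (k : ℝ) + 1 ≤ l := by exact_mod_cast h
        rw [abs_of_neg (by linarith)]
        linarith
      · have : (l : ℝ) + 1 ≤ k := by exact_mod_cast h
        rw [abs_of_pos (by linarith)]
        linarith
    exact div_le_div_of_nonneg_right this hm.le
  intro x hx y hy hxy
  rcases mem_symComb (Finset.mem_coe.1 hx) with rfl | ⟨k, hk, rfl⟩ | ⟨k, hk, rfl⟩ <;>
    rcases mem_symComb (Finset.mem_coe.1 hy) with rfl | ⟨l, hl, rfl⟩ | ⟨l, hl, rfl⟩
  · exact absurd rfl hxy
  · rw [dist_comm, dist_zero_right]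
    exact hsmall.trans (le_norm_combPt m l)
  · rw [dist_comm, dist_zero_right, norm_negCombPt]
    exact hsmall.trans (le_norm_combPt m l)
  · rw [dist_zero_right]
    exact hsmall.trans (le_norm_combPt m k)
  · rw [dist_combPt]
    exact hkl k l fun h => hxy (by rw [h])
  · exact hsmall.trans (by linarith [dist_combPt_negCombPt m k l])
  · rw [dist_zero_right, norm_negCombPt]
    exact hsmall.trans (le_norm_combPt m k)
  · rw [dist_comm]
    exact hsmall.trans (by linarith [dist_combPt_negCombPt m l k])
  · rw [negCombPt, negCombPt, dist_neg_neg, dist_combPt]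
    exact hkl k l fun h => hxy (by rw [h])

/-- Hence a rooted hard-core configuration. [folklore] -/
theorem isRootedHardCore_symComb (m : ℕ) :
    IsRootedHardCore (1 / (2 * ((m : ℝ) + 1)))
      ((Measure.count : Measure E3).restrict (↑(symComb m) : Set E3)) :=
  ⟨↑(symComb m), by simp [symComb], symComb_separated m, rfl⟩

/-- Root energy of the symmetric comb: `≤ −m/1000`. [folklore] -/
theorem rootEnergy_symComb_le (m : ℕ) :
    (∫ y, lennardJones ‖y‖ ∂((Measure.count : Measure E3).restrict (↑(symComb m) : Set E3))) / 2 ≤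
      -((m : ℝ) / 1000) := by
  rw [integral_count_restrict_coe_finset, symComb, Finset.sum_insert (zero_notMem_comb_images m),
    norm_zero, lennardJones_zero, zero_add, Finset.sum_union (disjoint_comb_images m),
    Finset.sum_image fun k _ l _ h => combPt_injective m h,
    Finset.sum_image fun k _ l _ h => negCombPt_injective m h]
  simp_rw [norm_negCombPt]
  have hle : ∑ k ∈ Finset.range m, lennardJones ‖combPt m k‖ ≤
      ∑ k ∈ Finset.range m, (-(1 / 1000) : ℝ) :=
    Finset.sum_le_sum fun k hk => lennardJones_le_on_comb_annulus (le_norm_combPt m k)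
      (norm_combPt_le (Finset.mem_range.1 hk))
  rw [Finset.sum_const, Finset.card_range, nsmul_eq_mul] at hle
  linarith

theorem rootEnergy_symComb_le_eStar :
    (∫ y, lennardJones ‖y‖ ∂((Measure.count : Measure E3).restrict (↑(symComb combSize) : Set E3)))
      / 2 ≤ eStar := by
  have h1 := rootEnergy_symComb_le combSize
  have h2 : -2000 * eStar ≤ (combSize : ℝ) := Nat.le_ceil _
  have h3 : (0 : ℝ) ≤ combSize := Nat.cast_nonneg _
  linarith

/-- The symmetric comb has an empty (bad) root shell. [folklore] -/
theorem not_goodShell_symComb (m : ℕ) :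
    ¬ GoodShell ((Measure.count : Measure E3).restrict (↑(symComb m) : Set E3)) := by
  refine not_goodShell_of_far fun y hy hy0 => ?_
  rw [count_restrict_singleton_ne_zero_iff] at hy
  rcases mem_symComb (Finset.mem_coe.1 hy) with rfl | ⟨k, -, rfl⟩ | ⟨k, -, rfl⟩
  · exact absurd rfl hy0
  · exact lt_of_lt_of_le (by norm_num) (le_norm_combPt m k)
  · rw [norm_negCombPt]
    exact lt_of_lt_of_le (by norm_num) (le_norm_combPt m k)

/-- The symmetric comb is symmetric: `Σ_{y} k(−y) = Σ_{y} k(y)` over it. [folklore] -/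
theorem sum_symComb_neg (m : ℕ) (k : E3 → ℝ≥0∞) :
    ∑ y ∈ symComb m, k (-y) = ∑ y ∈ symComb m, k y := by
  have himage : (symComb m).image (fun y : E3 => -y) = symComb m := by
    ext x
    simp only [Finset.mem_image]
    constructor
    · rintro ⟨y, hy, rfl⟩
      rcases mem_symComb hy with rfl | ⟨j, hj, rfl⟩ | ⟨j, hj, rfl⟩
      · simp [symComb]
      · simp only [symComb, Finset.mem_insert, Finset.mem_union, Finset.mem_image, Finset.mem_range]
        exact Or.inr (Or.inr ⟨j, hj, rfl⟩)
      · simp only [symComb, Finset.mem_insert, Finset.mem_union, Finset.mem_image, Finset.mem_range,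
          negCombPt, neg_neg]
        exact Or.inr (Or.inl ⟨j, hj, rfl⟩)
    · intro hx
      rcases mem_symComb hx with rfl | ⟨j, hj, rfl⟩ | ⟨j, hj, rfl⟩
      · exact ⟨0, by simp [symComb], neg_zero⟩
      · refine ⟨negCombPt m j, ?_, neg_neg _⟩
        simp only [symComb, Finset.mem_insert, Finset.mem_union, Finset.mem_image, Finset.mem_range]
        exact Or.inr (Or.inr ⟨j, hj, rfl⟩)
      · refine ⟨combPt m j, ?_, rfl⟩
        simp only [symComb, Finset.mem_insert, Finset.mem_union, Finset.mem_image, Finset.mem_range]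
        exact Or.inr (Or.inl ⟨j, hj, rfl⟩)
  conv_rhs => rw [← himage]
  rw [Finset.sum_image fun x _ y _ h => neg_injective h]

/-- `∫⁻ k d(count|F) = Σ_{y ∈ F} k y` for a finite set (no measurability needed). [folklore] -/
theorem lintegral_count_restrict_coe_finset (F : Finset E3) (k : E3 → ℝ≥0∞) :
    ∫⁻ y, k y ∂((Measure.count : Measure E3).restrict (↑F : Set E3)) = ∑ y ∈ F, k y := by
  rw [count_restrict_coe_finset, lintegral_finsetSum_measure]
  simp_rw [lintegral_dirac]

/-- The deterministic symmetric comb `δ_{count|symComb}` is reflection symmetric. [folklore] -/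
theorem isReflectionSymmetricLaw_dirac_symComb (m : ℕ) :
    IsReflectionSymmetricLaw (Measure.dirac ((Measure.count : Measure E3).restrict
      (↑(symComb m) : Set E3))) := by
  intro k _
  have hae := ae_eq_dirac_count_restrict (symComb m)
  have ev : ∀ G : Measure E3 → ℝ≥0∞, ∫⁻ μ, G μ ∂(Measure.dirac ((Measure.count : Measure E3).restrict
      (↑(symComb m) : Set E3)) : Measure (Measure E3)) =
      G ((Measure.count : Measure E3).restrict (↑(symComb m) : Set E3)) := fun G => by
    rw [lintegral_congr_ae (hae.mono fun μ hμ => by rw [hμ] :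
      (fun μ => G μ) =ᵐ[_] fun _ => G ((Measure.count : Measure E3).restrict ↑(symComb m))),
      lintegral_const, measure_univ, mul_one]
  rw [ev fun μ => ∫⁻ y, k y ∂μ, ev fun μ => ∫⁻ y, k (-y) ∂μ, lintegral_count_restrict_coe_finset,
    lintegral_count_restrict_coe_finset, sum_symComb_neg]

/-- **Reflection symmetry does not substitute for point-stationarity.** Witness: the deterministic
symmetric comb. [folklore] -/
theorem minimiserShells_false_withReflectionOnly : ¬ MinimiserShellsWithReflectionOnly := by
  intro h
  set F := symComb combSize
  have hae := ae_eq_dirac_count_restrict F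
  have hE : meanRootEnergy (Measure.dirac ((Measure.count : Measure E3).restrict (↑F : Set E3)))
      ≤ eStar := by
    rw [meanRootEnergy_dirac_count_restrict]
    exact rootEnergy_symComb_le_eStar
  have hgood := h _ (by positivity : (0 : ℝ) < 1 / (2 * ((combSize : ℝ) + 1))) _ inferInstance
    (hae.mono fun μ hμ => by rw [hμ]; exact isRootedHardCore_symComb combSize)
    (isReflectionSymmetricLaw_dirac_symComb combSize) hE
  obtain ⟨μ, hμg, hμe⟩ := (hgood.and hae).exists
  rw [hμe] at hμg
  exact not_goodShell_symComb combSize hμg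

/-! ### §7 Rootedness `0 ∈ S` is FREE

The clause `0 ∈ S` of hypothesis (i) can be deleted without changing the crux: the Mecke identity
with the transport `g(μ, y) = 1[μ{0} = 0]` ("an unrooted configuration sends mass `1` to each of its
points; nobody ever receives") forces `0 ∈ S ∨ S = ∅` almost surely, and `S = ∅` with positive
probability makes the conditioned law `P(· | S ≠ ∅)` — again point-stationary — STRICTLY sub-minimal
(`E < e*`, as `e* < 0`), contradicting `e_uni ≥ e*`, which the crux itself implies (§3). -/

/-- Unrooted `δ`-hard-core configuration: `μ = count|S`, `S` `δ`-separated, root NOT required. -/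
def IsHardCore (δ : ℝ) (μ : Measure E3) : Prop :=
  ∃ S : Set E3, (∀ x ∈ S, ∀ y ∈ S, x ≠ y → δ ≤ dist x y) ∧
    μ = (Measure.count : Measure E3).restrict S

theorem IsRootedHardCore.isHardCore {δ : ℝ} {μ : Measure E3} (h : IsRootedHardCore δ μ) :
    IsHardCore δ μ := by
  obtain ⟨S, -, hsep, hμ⟩ := h
  exact ⟨S, hsep, hμ⟩

/-- The crux with the clause `0 ∈ S` deleted. -/
def MinimiserShellsUnrooted : Prop :=
  ∀ δ : ℝ, 0 < δ → ∀ P : Measure (Measure E3), IsProbabilityMeasure P →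
    (∀ᵐ μ ∂P, IsHardCore δ μ) → IsPointStationaryLaw P → meanRootEnergy P ≤ eStar →
    ∀ᵐ μ ∂P, GoodShell μ

/-- Trivial direction. [folklore] -/
theorem minimiserShells_of_unrooted (h : MinimiserShellsUnrooted) : MinimiserShells := by
  rw [minimiserShells_iff]
  intro δ hδ P hP hcore hstat hE
  exact h δ hδ P hP (hcore.mono fun μ hμ => IsRootedHardCore.isHardCore hμ) hstat hE

/-- A `δ`-separated set (`δ > 0`) of `ℝ³` is countable (disjoint open balls in a separable space),
hence measurable. [folklore] -/
theorem countable_of_separated {δ : ℝ} (hδ : 0 < δ) {S : Set E3}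
    (hsep : ∀ x ∈ S, ∀ y ∈ S, x ≠ y → δ ≤ dist x y) : S.Countable := by
  have hdisj : S.PairwiseDisjoint fun x => Metric.ball x (δ / 2) := by
    intro x hx y hy hxy
    change Disjoint (Metric.ball x (δ / 2)) (Metric.ball y (δ / 2))
    refine Set.disjoint_left.2 fun z hzx hzy => ?_
    have h1 : dist z x < δ / 2 := Metric.mem_ball.1 hzx
    have h2 : dist z y < δ / 2 := Metric.mem_ball.1 hzy
    have h3 := hsep x hx y hy hxy
    linarith [dist_triangle_left x y z]
  exact hdisj.countable_of_isOpen (fun x _ => Metric.isOpen_ball)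
    fun x _ => ⟨x, Metric.mem_ball_self (by linarith)⟩

/-- **Mecke forces the root.** Under a point-stationary law a.s. carried by counting measures of
separated sets, almost surely the origin is a point or the configuration is empty. [folklore] -/
theorem ae_root_or_eq_zero {δ : ℝ} (hδ : 0 < δ) {P : Measure (Measure E3)}
    (hcore : ∀ᵐ μ ∂P, IsHardCore δ μ) (hstat : IsPointStationaryLaw P) :
    ∀ᵐ μ ∂P, μ {0} ≠ 0 ∨ μ = 0 := by
  classical
  set g : Measure E3 → E3 → ℝ≥0∞ := fun μ _ => if μ {0} = 0 then 1 else 0 with hg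
  have hset : MeasurableSet {μ : Measure E3 | μ {0} = 0} :=
    (Measure.measurable_coe (measurableSet_singleton (0 : E3))) (measurableSet_singleton 0)
  have hgm : Measurable (Function.uncurry g) :=
    Measurable.ite (measurable_fst hset) measurable_const measurable_const
  have hM := hstat g hgm
  have hL : ∫⁻ μ, ∫⁻ y, g μ y ∂μ ∂P = ∫⁻ μ, (if μ {0} = 0 then 1 else 0) * μ Set.univ ∂P := by
    refine lintegral_congr fun μ => ?_
    simp only [hg, lintegral_const]
  have hR : ∫⁻ μ, ∫⁻ y, g (Measure.map (fun z => z - y) μ) (-y) ∂μ ∂P = 0 := by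
    have hae : ∀ᵐ μ ∂P, ∫⁻ y, g (Measure.map (fun z => z - y) μ) (-y) ∂μ = 0 := by
      refine hcore.mono fun μ hμ => ?_
      obtain ⟨S, hsep, rfl⟩ := hμ
      have hS : MeasurableSet S := (countable_of_separated hδ hsep).measurableSet
      refine (lintegral_congr_ae ((ae_restrict_iff' hS).2 (Filter.Eventually.of_forall
        fun y hy => ?_))).trans lintegral_zero
      have h1 : (Measure.map (fun z => z - y) ((Measure.count : Measure E3).restrict S)) {0} ≠ 0 := by
        rw [Measure.map_apply (measurable_sub_const y) (measurableSet_singleton 0)]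
        have hpre : (fun z : E3 => z - y) ⁻¹' ({0} : Set E3) = {y} := by
          ext z
          simp [sub_eq_zero]
        rw [hpre]
        exact (count_restrict_singleton_ne_zero_iff S y).2 hy
      simp only [hg, if_neg h1]
    rw [lintegral_congr_ae hae, lintegral_zero]
  rw [hL, hR] at hM
  have hmeas : Measurable fun μ : Measure E3 =>
      (if μ {0} = 0 then (1 : ℝ≥0∞) else 0) * μ Set.univ :=
    (Measurable.ite hset measurable_const measurable_const).mul
      (Measure.measurable_coe MeasurableSet.univ)
  refine ((lintegral_eq_zero_iff hmeas).1 hM).mono fun μ hμ => ?_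
  simp only [Pi.zero_apply, mul_eq_zero, ite_eq_right_iff, one_ne_zero, imp_false] at hμ
  rcases hμ with h | h
  · exact Or.inl h
  · exact Or.inr (Measure.measure_univ_eq_zero.1 h)

/-- **Conditioning on a re-rooting-invariant event preserves point-stationarity.** [folklore] -/
theorem isPointStationaryLaw_restrict {P : Measure (Measure E3)} (hP : IsPointStationaryLaw P)
    {A : Set (Measure E3)} (hA : MeasurableSet A)
    (hinv : ∀ (μ : Measure E3) (y : E3), Measure.map (fun z => z - y) μ ∈ A ↔ μ ∈ A) :
    IsPointStationaryLaw (P.restrict A) := by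
  classical
  intro g hg
  set c : Measure E3 → ℝ≥0∞ := A.indicator fun _ => 1 with hc
  have hcm : Measurable c := measurable_const.indicator hA
  have hc_top : ∀ μ, c μ ≠ ⊤ := fun μ => by
    by_cases hμ : μ ∈ A
    · rw [hc, Set.indicator_of_mem hμ]; exact ENNReal.one_ne_top
    · rw [hc, Set.indicator_of_notMem hμ]; exact ENNReal.zero_ne_top
  have hc_map : ∀ (μ : Measure E3) (y : E3), c (Measure.map (fun z => z - y) μ) = c μ := by
    intro μ y
    by_cases hμ : μ ∈ A
    · rw [hc, Set.indicator_of_mem hμ, Set.indicator_of_mem ((hinv μ y).2 hμ)]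
    · rw [hc, Set.indicator_of_notMem hμ, Set.indicator_of_notMem fun h => hμ ((hinv μ y).1 h)]
  have pull : ∀ F : Measure E3 → ℝ≥0∞, ∫⁻ μ in A, F μ ∂P = ∫⁻ μ, c μ * F μ ∂P := by
    intro F
    rw [← lintegral_indicator hA]
    refine lintegral_congr fun μ => ?_
    by_cases hμ : μ ∈ A
    · rw [Set.indicator_of_mem hμ, hc, Set.indicator_of_mem hμ, one_mul]
    · rw [Set.indicator_of_notMem hμ, hc, Set.indicator_of_notMem hμ, zero_mul]
  have hg' : Measurable (Function.uncurry fun μ y => c μ * g μ y) :=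
    (hcm.comp measurable_fst).mul hg
  rw [pull, pull]
  calc ∫⁻ μ, c μ * ∫⁻ y, g μ y ∂μ ∂P = ∫⁻ μ, ∫⁻ y, c μ * g μ y ∂μ ∂P := by
        refine lintegral_congr fun μ => ?_
        rw [lintegral_const_mul' _ _ (hc_top μ)]
    _ = ∫⁻ μ, ∫⁻ y, c (Measure.map (fun z => z - y) μ) *
          g (Measure.map (fun z => z - y) μ) (-y) ∂μ ∂P := hP _ hg'
    _ = ∫⁻ μ, c μ * ∫⁻ y, g (Measure.map (fun z => z - y) μ) (-y) ∂μ ∂P := by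
        refine lintegral_congr fun μ => ?_
        simp_rw [hc_map]
        rw [lintegral_const_mul' _ _ (hc_top μ)]

/-- **Conditioning, almost-sure version**: it suffices that the event be invariant under re-rooting
at `μ`-almost every point for `P`-almost every configuration (the form provers meet: events defined
by almost-sure properties of the configuration). [folklore] -/
theorem isPointStationaryLaw_restrict_ae {P : Measure (Measure E3)} (hP : IsPointStationaryLaw P)
    {A : Set (Measure E3)} (hA : MeasurableSet A)
    (hinv : ∀ᵐ μ ∂P, ∀ᵐ y ∂μ, (Measure.map (fun z => z - y) μ ∈ A ↔ μ ∈ A)) :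
    IsPointStationaryLaw (P.restrict A) := by
  classical
  intro g hg
  set c : Measure E3 → ℝ≥0∞ := A.indicator fun _ => 1 with hc
  have hcm : Measurable c := measurable_const.indicator hA
  have hc_top : ∀ μ, c μ ≠ ⊤ := fun μ => by
    by_cases hμ : μ ∈ A
    · rw [hc, Set.indicator_of_mem hμ]; exact ENNReal.one_ne_top
    · rw [hc, Set.indicator_of_notMem hμ]; exact ENNReal.zero_ne_top
  have hc_map : ∀ᵐ μ ∂P, ∀ᵐ y ∂μ, c (Measure.map (fun z => z - y) μ) = c μ :=
    hinv.mono fun μ hμ => hμ.mono fun y hy => by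
      by_cases hμA : μ ∈ A
      · rw [hc, Set.indicator_of_mem hμA, Set.indicator_of_mem (hy.2 hμA)]
      · rw [hc, Set.indicator_of_notMem hμA, Set.indicator_of_notMem fun h => hμA (hy.1 h)]
  have pull : ∀ F : Measure E3 → ℝ≥0∞, ∫⁻ μ in A, F μ ∂P = ∫⁻ μ, c μ * F μ ∂P := by
    intro F
    rw [← lintegral_indicator hA]
    refine lintegral_congr fun μ => ?_
    by_cases hμ : μ ∈ A
    · rw [Set.indicator_of_mem hμ, hc, Set.indicator_of_mem hμ, one_mul]
    · rw [Set.indicator_of_notMem hμ, hc, Set.indicator_of_notMem hμ, zero_mul]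
  have hg' : Measurable (Function.uncurry fun μ y => c μ * g μ y) :=
    (hcm.comp measurable_fst).mul hg
  rw [pull, pull]
  calc ∫⁻ μ, c μ * ∫⁻ y, g μ y ∂μ ∂P = ∫⁻ μ, ∫⁻ y, c μ * g μ y ∂μ ∂P := by
        refine lintegral_congr fun μ => ?_
        rw [lintegral_const_mul' _ _ (hc_top μ)]
    _ = ∫⁻ μ, ∫⁻ y, c (Measure.map (fun z => z - y) μ) *
          g (Measure.map (fun z => z - y) μ) (-y) ∂μ ∂P := hP _ hg'
    _ = ∫⁻ μ, c μ * ∫⁻ y, g (Measure.map (fun z => z - y) μ) (-y) ∂μ ∂P := by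
        refine lintegral_congr_ae (hc_map.mono fun μ hμ => ?_)
        show ∫⁻ y, c (Measure.map (fun z => z - y) μ) * g (Measure.map (fun z => z - y) μ) (-y) ∂μ =
          c μ * ∫⁻ y, g (Measure.map (fun z => z - y) μ) (-y) ∂μ
        rw [lintegral_congr_ae (hμ.mono fun y hy => by simp only [hy] :
          (fun y => c (Measure.map (fun z => z - y) μ) * g (Measure.map (fun z => z - y) μ) (-y))
            =ᵐ[μ] fun y => c μ * g (Measure.map (fun z => z - y) μ) (-y)),
          lintegral_const_mul' _ _ (hc_top μ)]

/-- **The crux implies its unrooted version** (so `0 ∈ S` is not load-bearing: any proof may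
assume it, no proof needs it). [folklore] -/
theorem minimiserShellsUnrooted_of_minimiserShells (hMS : MinimiserShells) :
    MinimiserShellsUnrooted := by
  have hMS' := hMS
  rw [minimiserShells_iff] at hMS'
  have hU := minimiserShells_imp_unimodularEnergyLowerBound hMS
  rw [unimodularEnergyLowerBound_iff] at hU
  intro δ hδ P hP hcore hstat hE
  -- Step 0: `e* < 0` (else the lone root refutes the crux)
  have heneg : eStar < 0 := by
    by_contra h
    exact not_minimiserShellsSlack_of_neg_eStar_le (s := 0) (by linarith)
      (minimiserShellsSlack_zero_iff.2 hMS)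
  -- Step 1: a.s. rooted or empty
  have hroot : ∀ᵐ μ ∂P, μ {0} ≠ 0 ∨ μ = 0 := ae_root_or_eq_zero hδ hcore hstat
  set A : Set (Measure E3) := {μ | μ Set.univ ≠ 0} with hA
  have hAm : MeasurableSet A :=
    ((Measure.measurable_coe MeasurableSet.univ) (measurableSet_singleton (0 : ℝ≥0∞))).compl
  have hinv : ∀ (μ : Measure E3) (y : E3), Measure.map (fun z => z - y) μ ∈ A ↔ μ ∈ A := by
    intro μ y
    simp only [hA, Set.mem_setOf_eq, Measure.map_apply (measurable_sub_const y) MeasurableSet.univ,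
      Set.preimage_univ]
  have hcoreA : ∀ᵐ μ ∂P, μ ∈ A → IsRootedHardCore δ μ := by
    filter_upwards [hcore, hroot] with μ hc hr hμA
    obtain ⟨S, hsep, rfl⟩ := hc
    rcases hr with h0 | h0
    · exact ⟨S, (count_restrict_singleton_ne_zero_iff S 0).1 h0, hsep, rfl⟩
    · exfalso
      rw [h0] at hμA
      exact hμA (by simp)
  by_cases hfull : P Aᶜ = 0
  · have hmem : ∀ᵐ μ ∂P, μ ∈ A := by
      rw [ae_iff]
      exact hfull
    exact hMS' δ hδ P hP (by filter_upwards [hcoreA, hmem] with μ h1 h2 using h1 h2) hstat hE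
  · exfalso
    set F : Measure E3 → ℝ := fun μ => (∫ y, lennardJones ‖y‖ ∂μ) / 2 with hF
    have hEdef : meanRootEnergy P = ∫ μ, F μ ∂P := rfl
    have hint : Integrable F P := by
      by_contra hni
      rw [hEdef, integral_undef hni] at hE
      linarith
    have hFzero : ∀ μ ∈ Aᶜ, F μ = 0 := by
      intro μ hμ
      have hu : μ Set.univ = 0 := by
        simpa [hA] using hμ
      have : μ = 0 := Measure.measure_univ_eq_zero.1 hu
      simp [hF, this]
    have hsplit : ∫ μ, F μ ∂P = ∫ μ in A, F μ ∂P := by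
      rw [← integral_add_compl hAm hint, setIntegral_eq_zero_of_forall_eq_zero hFzero, add_zero]
    have hpA0 : P A ≠ 0 := by
      intro h0
      have h1 : ∫ μ in A, F μ ∂P = 0 := by
        rw [Measure.restrict_eq_zero.2 h0, integral_zero_measure]
      rw [hEdef, hsplit, h1] at hE
      linarith
    have hpA1 : P A < 1 := by
      by_contra hge
      have h1 : P A = 1 := le_antisymm prob_le_one (not_lt.1 hge)
      apply hfull
      rw [prob_compl_eq_one_sub hAm, h1, tsub_self]
    set p : ℝ≥0∞ := P A with hp
    have hp_top : p ≠ ⊤ := measure_ne_top P A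
    set PA : Measure (Measure E3) := p⁻¹ • P.restrict A with hPA
    haveI : IsProbabilityMeasure PA := ⟨by
      rw [hPA, Measure.smul_apply, Measure.restrict_apply MeasurableSet.univ, Set.univ_inter,
        smul_eq_mul, ENNReal.inv_mul_cancel hpA0 hp_top]⟩
    have hstatA : IsPointStationaryLaw PA := (isPointStationaryLaw_restrict hstat hAm hinv).smul _
    have hcorePA : ∀ᵐ μ ∂PA, IsRootedHardCore δ μ := by
      rw [hPA]
      refine Measure.ae_smul_measure ?_ _
      have h1 : ∀ᵐ μ ∂(P.restrict A), μ ∈ A := ae_restrict_mem hAm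
      have h2 : ∀ᵐ μ ∂(P.restrict A), μ ∈ A → IsRootedHardCore δ μ := ae_restrict_of_ae hcoreA
      filter_upwards [h1, h2] with μ h1 h2 using h2 h1
    have hEPA : meanRootEnergy PA = (p⁻¹).toReal * meanRootEnergy P := by
      rw [hEdef, hsplit, show meanRootEnergy PA = ∫ μ, F μ ∂PA from rfl, hPA, integral_smul_measure,
        smul_eq_mul]
    have hlow : eStar ≤ meanRootEnergy PA := hU δ hδ PA inferInstance hcorePA hstatA
    rw [hEPA, ENNReal.toReal_inv] at hlow
    have hpreal0 : 0 < p.toReal := ENNReal.toReal_pos hpA0 hp_top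
    have hpreal1 : p.toReal < 1 := by
      have := (ENNReal.toReal_lt_toReal hp_top ENNReal.one_ne_top).2 hpA1
      rwa [ENNReal.toReal_one] at this
    have hq1 : 1 < p.toReal⁻¹ := (one_lt_inv₀ hpreal0).2 hpreal1
    have h1 := mul_le_mul_of_nonneg_left hE (inv_pos.2 hpreal0).le
    have h2 := mul_pos (sub_pos.2 hq1) (neg_pos.2 heneg)
    nlinarith

/-- **`0 ∈ S` is free**: the crux and its unrooted version are equivalent. [folklore] -/
theorem minimiserShellsUnrooted_iff : MinimiserShellsUnrooted ↔ MinimiserShells :=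
  ⟨minimiserShells_of_unrooted, minimiserShellsUnrooted_of_minimiserShells⟩

/-! ### §7b The minimising face is closed under invariant conditioning (a tool, not an attack) -/

/-- **The minimising face is closed under invariant conditioning.** Given `e_uni ≥ e*`
(`UnimodularEnergyLowerBound`, unfolded) and `e* < 0`: if `P` is a minimising point-stationary
`δ`-hard-core probability law and `A` a measurable re-rooting-invariant event with `P(A) > 0`, the
conditioned law `P(A)⁻¹ • P|A` (again point-stationary, `isPointStationaryLaw_restrict`, rooted and
hard-core) is minimising too: `E_{P(·|A)}[h] ≤ e*`.  (Linearity: `E_P = P(A)·E_A + P(Aᶜ)·E_{Aᶜ}`, both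
conditional energies are `≥ e*`.)  This is the "density zero ⇒ almost surely" / ergodic-component
step of every line on the crux and on `LayeredLawsSelectHcp`. [folklore] -/
theorem meanRootEnergy_cond_le_of_minimising (heneg : eStar < 0)
    (hU : ∀ δ : ℝ, 0 < δ → ∀ P : Measure (Measure E3), IsProbabilityMeasure P →
      (∀ᵐ μ ∂P, IsRootedHardCore δ μ) → IsPointStationaryLaw P → eStar ≤ meanRootEnergy P)
    {δ : ℝ} (hδ : 0 < δ) (P : Measure (Measure E3)) [IsProbabilityMeasure P]
    (hcore : ∀ᵐ μ ∂P, IsRootedHardCore δ μ) (hstat : IsPointStationaryLaw P)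
    (hE : meanRootEnergy P ≤ eStar) {A : Set (Measure E3)} (hA : MeasurableSet A)
    (hinv : ∀ (μ : Measure E3) (y : E3), Measure.map (fun z => z - y) μ ∈ A ↔ μ ∈ A)
    (hpA : P A ≠ 0) :
    meanRootEnergy ((P A)⁻¹ • P.restrict A) ≤ eStar := by
  set F : Measure E3 → ℝ := fun μ => (∫ y, lennardJones ‖y‖ ∂μ) / 2 with hF
  have hEdef : ∀ Q : Measure (Measure E3), meanRootEnergy Q = ∫ μ, F μ ∂Q := fun Q => rfl
  have hint : Integrable F P := by
    by_contra hni
    rw [hEdef, integral_undef hni] at hE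
    linarith
  have hsplit : ∫ μ, F μ ∂P = (∫ μ in A, F μ ∂P) + ∫ μ in Aᶜ, F μ ∂P :=
    (integral_add_compl hA hint).symm
  -- the conditioned law on a measurable invariant event `B` of positive probability
  have cond : ∀ (B : Set (Measure E3)), MeasurableSet B →
      (∀ (μ : Measure E3) (y : E3), Measure.map (fun z => z - y) μ ∈ B ↔ μ ∈ B) → P B ≠ 0 →
      (P B).toReal * eStar ≤ ∫ μ in B, F μ ∂P ∧
        meanRootEnergy ((P B)⁻¹ • P.restrict B) = (P B).toReal⁻¹ * ∫ μ in B, F μ ∂P := by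
    intro B hB hinvB hpB
    have hp_top : P B ≠ ⊤ := measure_ne_top P B
    set PB : Measure (Measure E3) := (P B)⁻¹ • P.restrict B with hPB
    haveI : IsProbabilityMeasure PB := ⟨by
      rw [hPB, Measure.smul_apply, Measure.restrict_apply MeasurableSet.univ, Set.univ_inter,
        smul_eq_mul, ENNReal.inv_mul_cancel hpB hp_top]⟩
    have hstatB : IsPointStationaryLaw PB := (isPointStationaryLaw_restrict hstat hB hinvB).smul _
    have hcoreB : ∀ᵐ μ ∂PB, IsRootedHardCore δ μ := by
      rw [hPB]
      exact Measure.ae_smul_measure (ae_restrict_of_ae hcore) _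
    have hEB : meanRootEnergy PB = (P B).toReal⁻¹ * ∫ μ in B, F μ ∂P := by
      rw [hEdef, hPB, integral_smul_measure, smul_eq_mul, ENNReal.toReal_inv]
    have hlow : eStar ≤ meanRootEnergy PB := hU δ hδ PB inferInstance hcoreB hstatB
    refine ⟨?_, hEB⟩
    rw [hEB] at hlow
    have hpos : 0 < (P B).toReal := ENNReal.toReal_pos hpB hp_top
    calc (P B).toReal * eStar ≤ (P B).toReal * ((P B).toReal⁻¹ * ∫ μ in B, F μ ∂P) :=
          mul_le_mul_of_nonneg_left hlow hpos.le
      _ = ∫ μ in B, F μ ∂P := by rw [← mul_assoc, mul_inv_cancel₀ hpos.ne', one_mul]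
  obtain ⟨hAlow, hEA⟩ := cond A hA hinv hpA
  have hposA : 0 < (P A).toReal := ENNReal.toReal_pos hpA (measure_ne_top P A)
  rw [hEA]
  -- it remains to see `∫_A F ≤ P(A)·e*`
  suffices hmain : ∫ μ in A, F μ ∂P ≤ (P A).toReal * eStar by
    calc (P A).toReal⁻¹ * ∫ μ in A, F μ ∂P ≤ (P A).toReal⁻¹ * ((P A).toReal * eStar) :=
          mul_le_mul_of_nonneg_left hmain (inv_pos.2 hposA).le
      _ = eStar := by rw [← mul_assoc, inv_mul_cancel₀ hposA.ne', one_mul]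
  have hsum : (P A).toReal + (P Aᶜ).toReal = 1 := by
    rw [← ENNReal.toReal_add (measure_ne_top P A) (measure_ne_top P Aᶜ),
      measure_add_measure_compl hA, measure_univ, ENNReal.toReal_one]
  by_cases hqA : P Aᶜ = 0
  · have h0 : ∫ μ in Aᶜ, F μ ∂P = 0 := by
      rw [Measure.restrict_eq_zero.2 hqA, integral_zero_measure]
    have h1 : (P A).toReal = 1 := by
      rw [hqA, ENNReal.toReal_zero, add_zero] at hsum
      exact hsum
    have h2 : ∫ μ in A, F μ ∂P = meanRootEnergy P := by
      rw [hEdef, hsplit, h0, add_zero]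
    rw [h1, one_mul, h2]
    exact hE
  · have hinvc : ∀ (μ : Measure E3) (y : E3), Measure.map (fun z => z - y) μ ∈ Aᶜ ↔ μ ∈ Aᶜ :=
      fun μ y => not_congr (hinv μ y)
    obtain ⟨hAclow, -⟩ := cond Aᶜ hA.compl hinvc hqA
    have hEP : ∫ μ, F μ ∂P ≤ eStar := by rw [← hEdef]; exact hE
    rw [hsplit] at hEP
    nlinarith



/-! ### §8 The ceiling on the pricing constant for PARTIALLY bad laws -/

/-- **Ceiling from a partially bad law**: a point-stationary hard-core law with `P(bad) ≥ q > 0`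
caps the constant, `c ≤ (E_P[h] − e*)/q` — dilute defects (one displaced atom per `M` sites:
`q = #bad shells/M`, `E − e* = ΔE/M`) give `c ≤ ΔE/#bad shells`; kit j010609: `ΔE = 1.87e-3` at
`|u| = a/100` (one bad shell), `7.5e-3` at `2a/100` (thirteen bad shells, `c ≤ 5.8e-4`) — no better than
homogeneous strain (`3.4–5.6e-4`, §5 and the module index). [folklore] -/
theorem linearPricing_ceiling_partial {c : ℝ} (hc : 0 ≤ c) (h : LinearPricing c) {δ : ℝ}
    (hδ : 0 < δ) (P : Measure (Measure E3)) [IsProbabilityMeasure P]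
    (hcore : ∀ᵐ μ ∂P, IsRootedHardCore δ μ) (hstat : IsPointStationaryLaw P) {q : ℝ} (hq : 0 < q)
    (hbad : q ≤ (P {μ | ¬ GoodShell μ}).toReal) :
    c ≤ (meanRootEnergy P - eStar) / q := by
  have hineq := h δ hδ P inferInstance hcore hstat
  rw [le_div_iff₀ hq]
  nlinarith [mul_le_mul_of_nonneg_left hbad hc]


/-! ## §9 (gen 3) FINITE-RANGE MASS TRANSPORT IS NOT ENOUGH — AT ANY RANGE

The Mecke identity quantifies over ALL measurable transports `g ≥ 0`.  Restrict it to transports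
of METRIC RANGE `≤ R` (`g(μ, y) = 0` whenever `‖y‖ > R`: no mass travels farther than `R`) and the
crux becomes FALSE, for every `R`.  Witness: the deterministic FAR COMB `δ_{count|F}`,
`F = {0} ∪ {(R + 3/2 + k/(2m+2))•e₀ : k < m}`, `m = ⌈−24 (R+2)⁶ e*⌉₊`: every tooth is farther than
`R` from the root, so a range-`R` transport out of or into the root sees only the root itself and
the `R`-local identity holds trivially; the law is `1/(2m+2)`-hard-core, has ROOT energy
`≤ −m/(24 (R+2)⁶) ≤ e*` (`V_LJ ≤ −1/(12 (R+2)⁶)` on `[1, R+2]`) and an EMPTY root shell.  (`R = 0`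
is §2b's comb.)  Since `IsLocallyPointStationaryLaw R ↑ IsPointStationaryLaw` as `R → ∞`
(monotone convergence), the localising power of Mecke lies ENTIRELY in transports of unbounded
range: a proof of the crux must move mass beyond every fixed distance — as the Palm-density
transports `1[‖y‖ ≤ R]·…` (`R → ∞`) and the random-grid periodisation of 9229 (cells `L → ∞`) do —
and no bounded-radius bookkeeping (first/second-shell exchanges, bounded-radius star or ring
identities) combined with `E_P[h] ≤ e*` can give it.  Landing file: `Negative/LocalMecke.lean`. -/

/-- **`R`-local point-stationarity**: the Mecke identity for transports of metric range `≤ R` only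
(`g(μ, y) = 0` whenever `‖y‖ > R`). -/
def IsLocallyPointStationaryLaw (R : ℝ) (P : Measure (Measure E3)) : Prop :=
  ∀ g : Measure E3 → E3 → ℝ≥0∞, Measurable (Function.uncurry g) →
    (∀ μ y, R < ‖y‖ → g μ y = 0) →
    ∫⁻ μ, ∫⁻ y, g μ y ∂μ ∂P = ∫⁻ μ, ∫⁻ y, g (Measure.map (fun z => z - y) μ) (-y) ∂μ ∂P

/-- Point-stationary laws are `R`-locally point-stationary for every `R`. [folklore] -/
theorem isLocallyPointStationaryLaw_of_isPointStationaryLaw {P : Measure (Measure E3)}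
    (h : IsPointStationaryLaw P) (R : ℝ) : IsLocallyPointStationaryLaw R P :=
  fun g hg _ => h g hg

/-- `R`-local point-stationarity is monotone: a larger range is a stronger condition. [folklore] -/
theorem IsLocallyPointStationaryLaw.mono {R R' : ℝ} (hRR' : R ≤ R') {P : Measure (Measure E3)}
    (h : IsLocallyPointStationaryLaw R' P) : IsLocallyPointStationaryLaw R P :=
  fun g hg hgR => h g hg fun μ y hy => hgR μ y (lt_of_le_of_lt hRR' hy)

/-- The crux with point-stationarity WEAKENED to `R`-local point-stationarity. -/
def MinimiserShellsWithLocalMecke (R : ℝ) : Prop :=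
  ∀ δ : ℝ, 0 < δ → ∀ P : Measure (Measure E3), IsProbabilityMeasure P →
    (∀ᵐ μ ∂P, IsRootedHardCore δ μ) → IsLocallyPointStationaryLaw R P → meanRootEnergy P ≤ eStar →
    ∀ᵐ μ ∂P, GoodShell μ

/-- Each local version implies the crux (trivial direction). [folklore] -/
theorem minimiserShells_of_withLocalMecke {R : ℝ} (h : MinimiserShellsWithLocalMecke R) :
    MinimiserShells := by
  rw [minimiserShells_iff]
  intro δ hδ P hP hcore hstat hE
  exact h δ hδ P hP hcore (isLocallyPointStationaryLaw_of_isPointStationaryLaw hstat R) hE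

/-- The local versions are monotone in the range. [folklore] -/
theorem MinimiserShellsWithLocalMecke.mono {R R' : ℝ} (hRR' : R ≤ R')
    (h : MinimiserShellsWithLocalMecke R) : MinimiserShellsWithLocalMecke R' :=
  fun δ hδ P hP hcore hstat hE => h δ hδ P hP hcore (hstat.mono hRR') hE

/-- **Deterministic laws whose non-root points are far are `R`-locally point-stationary**: if `F`
is a finite configuration containing the root all of whose other points have norm `> R`, then
`δ_{count|F}` satisfies the `R`-local Mecke identity (both sides equal `g(count|F, 0)`).
[folklore] -/
theorem isLocallyPointStationaryLaw_dirac_of_far {R : ℝ} {F : Finset E3} (h0 : (0 : E3) ∈ F)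
    (hfar : ∀ y ∈ F, y ≠ 0 → R < ‖y‖) :
    IsLocallyPointStationaryLaw R
      (Measure.dirac ((Measure.count : Measure E3).restrict (↑F : Set E3))) := by
  classical
  intro g _ hgR
  set μ₀ : Measure E3 := (Measure.count : Measure E3).restrict (↑F : Set E3) with hμ₀
  have hae := ae_eq_dirac_count_restrict F
  have ev : ∀ G : Measure E3 → ℝ≥0∞,
      ∫⁻ μ, G μ ∂(Measure.dirac μ₀ : Measure (Measure E3)) = G μ₀ := fun G => by
    rw [lintegral_congr_ae (hae.mono fun μ hμ => by rw [hμ] :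
      (fun μ => G μ) =ᵐ[_] fun _ => G μ₀), lintegral_const, measure_univ, mul_one]
  rw [ev fun μ => ∫⁻ y, g μ y ∂μ, ev fun μ => ∫⁻ y, g (Measure.map (fun z => z - y) μ) (-y) ∂μ,
    hμ₀, lintegral_count_restrict_coe_finset, lintegral_count_restrict_coe_finset,
    ← Finset.add_sum_erase F _ h0, ← Finset.add_sum_erase F _ h0]
  have hmap : Measure.map (fun z : E3 => z - 0) ((Measure.count : Measure E3).restrict (↑F : Set E3))
      = (Measure.count : Measure E3).restrict (↑F : Set E3) := by
    simp only [sub_zero]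
    exact Measure.map_id
  rw [hmap, neg_zero]
  congr 1
  rw [Finset.sum_eq_zero, Finset.sum_eq_zero]
  · intro y hy
    obtain ⟨hy0, hyF⟩ := Finset.mem_erase.1 hy
    exact hgR _ _ (by rw [norm_neg]; exact hfar y hyF hy0)
  · intro y hy
    obtain ⟨hy0, hyF⟩ := Finset.mem_erase.1 hy
    exact hgR _ _ (hfar y hyF hy0)

/-! ### The far comb -/

/-- The `k`-th tooth `(R + 3/2 + k/(2(m+1))) • e₀`. -/
def farCombPt (R : ℝ) (m k : ℕ) : E3 := (R + 3 / 2 + (k : ℝ) / (2 * ((m : ℝ) + 1))) • e0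

/-- The far comb: the root plus `m` teeth on `[R + 3/2, R + 2)·e₀`. -/
def farComb (R : ℝ) (m : ℕ) : Finset E3 := insert 0 ((Finset.range m).image (farCombPt R m))

/-- `‖farCombPt R m k‖ = R + 3/2 + k/(2(m+1))`. [folklore] -/
theorem norm_farCombPt {R : ℝ} (hR : 0 ≤ R) (m k : ℕ) :
    ‖farCombPt R m k‖ = R + 3 / 2 + (k : ℝ) / (2 * ((m : ℝ) + 1)) := by
  rw [farCombPt, norm_smul, norm_e0, mul_one, Real.norm_of_nonneg (by positivity)]

/-- Teeth are at distance `≥ R + 3/2` from the root. [folklore] -/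
theorem le_norm_farCombPt {R : ℝ} (hR : 0 ≤ R) (m k : ℕ) : R + 3 / 2 ≤ ‖farCombPt R m k‖ := by
  rw [norm_farCombPt hR]
  have : (0 : ℝ) ≤ (k : ℝ) / (2 * ((m : ℝ) + 1)) := by positivity
  linarith

/-- Teeth are at distance `≤ R + 2` from the root. [folklore] -/
theorem norm_farCombPt_le {R : ℝ} (hR : 0 ≤ R) {m k : ℕ} (hk : k < m) :
    ‖farCombPt R m k‖ ≤ R + 2 := by
  rw [norm_farCombPt hR]
  have hm : (0 : ℝ) < 2 * ((m : ℝ) + 1) := by positivity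
  have hk' : (k : ℝ) ≤ (m : ℝ) + 1 := by
    have : (k : ℝ) < m := by exact_mod_cast hk
    linarith
  have : (k : ℝ) / (2 * ((m : ℝ) + 1)) ≤ 1 / 2 := by
    rw [div_le_iff₀ hm]
    linarith
  linarith

/-- Teeth are not the root. [folklore] -/
theorem farCombPt_ne_zero {R : ℝ} (hR : 0 ≤ R) (m k : ℕ) : farCombPt R m k ≠ 0 := by
  intro h
  have := le_norm_farCombPt hR m k
  rw [h, norm_zero] at this
  linarith

/-- Mutual distances of the teeth. [folklore] -/
theorem dist_farCombPt (R : ℝ) (m k l : ℕ) :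
    dist (farCombPt R m k) (farCombPt R m l) = |(k : ℝ) - l| / (2 * ((m : ℝ) + 1)) := by
  rw [dist_eq_norm, farCombPt, farCombPt, ← sub_smul, norm_smul, norm_e0, mul_one]
  have hm : (0 : ℝ) < 2 * ((m : ℝ) + 1) := by positivity
  rw [show R + 3 / 2 + (k : ℝ) / (2 * ((m : ℝ) + 1)) - (R + 3 / 2 + (l : ℝ) / (2 * ((m : ℝ) + 1))) =
      ((k : ℝ) - l) / (2 * ((m : ℝ) + 1)) by ring, Real.norm_eq_abs, abs_div, abs_of_pos hm]

/-- The teeth are distinct. [folklore] -/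
theorem farCombPt_injective (R : ℝ) (m : ℕ) : Function.Injective (farCombPt R m) := by
  intro k l h
  have hd := dist_farCombPt R m k l
  rw [h, dist_self] at hd
  have hm : (0 : ℝ) < 2 * ((m : ℝ) + 1) := by positivity
  have h0 : |(k : ℝ) - l| = 0 := by
    have := hd.symm
    rwa [div_eq_zero_iff, or_iff_left hm.ne'] at this
  have : (k : ℝ) = l := by
    have := abs_eq_zero.1 h0
    linarith
  exact_mod_cast this

/-- The far comb is `1/(2(m+1))`-separated. [folklore] -/
theorem farComb_separated {R : ℝ} (hR : 0 ≤ R) (m : ℕ) :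
    ∀ x ∈ (↑(farComb R m) : Set E3), ∀ y ∈ (↑(farComb R m) : Set E3), x ≠ y →
      1 / (2 * ((m : ℝ) + 1)) ≤ dist x y := by
  have hm : (0 : ℝ) < 2 * ((m : ℝ) + 1) := by positivity
  have hsmall : 1 / (2 * ((m : ℝ) + 1)) ≤ R + 3 / 2 := by
    rw [div_le_iff₀ hm]
    have : (0 : ℝ) ≤ m := by positivity
    nlinarith
  intro x hx y hy hxy
  simp only [farComb, Finset.coe_insert, Finset.coe_image, Finset.coe_range, Set.mem_insert_iff,
    Set.mem_image, Set.mem_Iio] at hx hy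
  rcases hx with rfl | ⟨k, hk, rfl⟩ <;> rcases hy with rfl | ⟨l, hl, rfl⟩
  · exact absurd rfl hxy
  · rw [dist_comm, dist_zero_right]
    exact hsmall.trans (le_norm_farCombPt hR m l)
  · rw [dist_zero_right]
    exact hsmall.trans (le_norm_farCombPt hR m k)
  · rw [dist_farCombPt]
    have hkl : k ≠ l := fun h => hxy (by rw [h])
    have : (1 : ℝ) ≤ |(k : ℝ) - l| := by
      rcases lt_or_gt_of_ne hkl with h | h
      · have : (k : ℝ) + 1 ≤ l := by exact_mod_cast h
        rw [abs_of_neg (by linarith)]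
        linarith
      · have : (l : ℝ) + 1 ≤ k := by exact_mod_cast h
        rw [abs_of_pos (by linarith)]
        linarith
    exact div_le_div_of_nonneg_right this hm.le

/-- The far comb as a rooted hard-core configuration. [folklore] -/
theorem isRootedHardCore_farComb {R : ℝ} (hR : 0 ≤ R) (m : ℕ) :
    IsRootedHardCore (1 / (2 * ((m : ℝ) + 1)))
      ((Measure.count : Measure E3).restrict (↑(farComb R m) : Set E3)) :=
  ⟨↑(farComb R m), by simp [farComb], farComb_separated hR m, rfl⟩

/-- `V_LJ(r) ≤ −1/(12 ρ⁶)` for `1 ≤ r ≤ ρ` (with `u = r⁻¹ ∈ [ρ⁻¹, 1]`: `u¹² ≤ u⁶`, so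
`V = u¹²/12 − u⁶/6 ≤ −u⁶/12`). [folklore] -/
theorem lennardJones_le_of_one_le {r ρ : ℝ} (h1 : 1 ≤ r) (h2 : r ≤ ρ) :
    lennardJones r ≤ -(1 / (12 * ρ ^ 6)) := by
  have hr : 0 < r := by linarith
  have hρ : 0 < ρ := by linarith
  have hu0 : 0 < r⁻¹ := inv_pos.2 hr
  have hu1 : r⁻¹ ≤ 1 := inv_le_one_of_one_le₀ h1
  have huρ : ρ⁻¹ ≤ r⁻¹ := (inv_le_inv₀ hρ hr).2 h2
  have h6 : (r⁻¹) ^ 6 ≤ 1 := pow_le_one₀ hu0.le hu1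
  have h6ρ : (ρ⁻¹) ^ 6 ≤ (r⁻¹) ^ 6 := pow_le_pow_left₀ (inv_pos.2 hρ).le huρ 6
  have h12 : (r⁻¹) ^ 12 ≤ (r⁻¹) ^ 6 := by
    have : (r⁻¹) ^ 12 = (r⁻¹) ^ 6 * (r⁻¹) ^ 6 := by ring
    rw [this]
    exact mul_le_of_le_one_right (by positivity) h6
  have hρ6 : (ρ⁻¹) ^ 6 = 1 / ρ ^ 6 := by rw [inv_pow, one_div]
  unfold lennardJones
  rw [show -(1 / (12 * ρ ^ 6)) = -(1 / 12) * (ρ⁻¹) ^ 6 by rw [hρ6]; ring]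
  nlinarith [h6ρ, h12]

/-- Root energy of the far comb: `½ Σ_y V_LJ(‖y‖) ≤ −m/(24 (R+2)⁶)`. [folklore] -/
theorem rootEnergy_farComb_le {R : ℝ} (hR : 0 ≤ R) (m : ℕ) :
    (∫ y, lennardJones ‖y‖ ∂((Measure.count : Measure E3).restrict (↑(farComb R m) : Set E3))) / 2
      ≤ -((m : ℝ) / (24 * (R + 2) ^ 6)) := by
  rw [integral_count_restrict_coe_finset]
  have h0 : (0 : E3) ∉ (Finset.range m).image (farCombPt R m) := by
    simp only [Finset.mem_image, Finset.mem_range, not_exists, not_and]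
    exact fun k _ => farCombPt_ne_zero hR m k
  rw [farComb, Finset.sum_insert h0, norm_zero, lennardJones_zero, zero_add,
    Finset.sum_image fun k _ l _ h => farCombPt_injective R m h]
  have hle : ∑ k ∈ Finset.range m, lennardJones ‖farCombPt R m k‖ ≤
      ∑ k ∈ Finset.range m, (-(1 / (12 * (R + 2) ^ 6)) : ℝ) :=
    Finset.sum_le_sum fun k hk => lennardJones_le_of_one_le
      (by linarith [le_norm_farCombPt hR m k]) (norm_farCombPt_le hR (Finset.mem_range.1 hk))
  rw [Finset.sum_const, Finset.card_range, nsmul_eq_mul] at hle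
  have hρ : (0 : ℝ) < 24 * (R + 2) ^ 6 := by positivity
  have : (m : ℝ) * -(1 / (12 * (R + 2) ^ 6)) = -(2 * ((m : ℝ) / (24 * (R + 2) ^ 6))) := by
    field_simp
    ring
  rw [this] at hle
  linarith

/-- The far comb's root shell is empty, hence bad. [folklore] -/
theorem not_goodShell_farComb {R : ℝ} (hR : 0 ≤ R) (m : ℕ) :
    ¬ GoodShell ((Measure.count : Measure E3).restrict (↑(farComb R m) : Set E3)) := by
  refine not_goodShell_of_far fun y hy hy0 => ?_
  rw [count_restrict_singleton_ne_zero_iff] at hy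
  simp only [farComb, Finset.coe_insert, Finset.coe_image, Finset.coe_range, Set.mem_insert_iff,
    Set.mem_image, Set.mem_Iio] at hy
  rcases hy with rfl | ⟨k, -, rfl⟩
  · exact absurd rfl hy0
  · exact lt_of_lt_of_le (by linarith) (le_norm_farCombPt hR m k)

/-- Teeth of the far comb are farther than `R` from the root. [folklore] -/
theorem far_of_mem_farComb {R : ℝ} (hR : 0 ≤ R) (m : ℕ) :
    ∀ y ∈ farComb R m, y ≠ 0 → R < ‖y‖ := by
  intro y hy hy0
  simp only [farComb, Finset.mem_insert, Finset.mem_image, Finset.mem_range] at hy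
  rcases hy with rfl | ⟨k, -, rfl⟩
  · exact absurd rfl hy0
  · exact lt_of_lt_of_le (by linarith) (le_norm_farCombPt hR m k)

/-- The number of teeth that beats `e*` at range `R`: `⌈−24 (R+2)⁶ e*⌉₊`. -/
def farCombSize (R : ℝ) : ℕ := ⌈-(24 * (R + 2) ^ 6) * eStar⌉₊

/-- With `farCombSize R` teeth the root energy is `≤ e*`. [folklore] -/
theorem rootEnergy_farComb_le_eStar {R : ℝ} (hR : 0 ≤ R) :
    (∫ y, lennardJones ‖y‖ ∂((Measure.count : Measure E3).restrict
      (↑(farComb R (farCombSize R)) : Set E3))) / 2 ≤ eStar := by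
  have h1 := rootEnergy_farComb_le hR (farCombSize R)
  have h2 : -(24 * (R + 2) ^ 6) * eStar ≤ (farCombSize R : ℝ) := Nat.le_ceil _
  have hρ : (0 : ℝ) < 24 * (R + 2) ^ 6 := by positivity
  have h3 : -((farCombSize R : ℝ) / (24 * (R + 2) ^ 6)) ≤ eStar := by
    rw [neg_le, le_div_iff₀ hρ]
    linarith
  exact h1.trans h3

/-- The local version at a non-negative range is false (far comb at that range). [folklore] -/
theorem minimiserShells_false_withLocalMecke_of_nonneg {R : ℝ} (hR : 0 ≤ R) :
    ¬ MinimiserShellsWithLocalMecke R := by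
  intro h
  set F := farComb R (farCombSize R)
  have hae := ae_eq_dirac_count_restrict F
  have hE : meanRootEnergy (Measure.dirac ((Measure.count : Measure E3).restrict (↑F : Set E3)))
      ≤ eStar := by
    rw [meanRootEnergy_dirac_count_restrict]
    exact rootEnergy_farComb_le_eStar hR
  have hgood := h _ (by positivity : (0 : ℝ) < 1 / (2 * ((farCombSize R : ℝ) + 1))) _ inferInstance
    (hae.mono fun μ hμ => by rw [hμ]; exact isRootedHardCore_farComb hR (farCombSize R))
    (isLocallyPointStationaryLaw_dirac_of_far (by simp [F, farComb])
      (far_of_mem_farComb hR (farCombSize R))) hE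
  obtain ⟨μ, hμg, hμe⟩ := (hgood.and hae).exists
  rw [hμe] at hμg
  exact not_goodShell_farComb hR (farCombSize R) hμg

/-- **Finite-range mass transport is not enough, at any range.** For every `R`, the crux with the
Mecke identity assumed only for transports vanishing beyond distance `R` is FALSE. [folklore] -/
theorem minimiserShells_false_withLocalMecke (R : ℝ) : ¬ MinimiserShellsWithLocalMecke R :=
  fun h => minimiserShells_false_withLocalMecke_of_nonneg (le_max_right R 0) (h.mono (le_max_left R 0))

/-! ## §4b (gen 3) NO SLACK VERSION HOLDS — now UNCONDITIONALLY

Item 0626 `CrysEnergyLimit` is proved in the tree (`Theorems.crysEnergyLimit_proof`, via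
`ChargedEnergyGapNegative.crysEnergyLimit`), so §4's conditional refutation of every slack version
is unconditional: for every `s > 0` there are point-stationary hard-core probability laws (uniformly
rooted ground states mixed with the lone root) of energy `≤ e* + s` with an empty root shell of
positive probability. -/

/-- **No slack version of the crux holds**, unconditionally. [folklore] -/
theorem not_minimiserShellsSlack {s : ℝ} (hs : 0 < s) : ¬ MinimiserShellsSlack s :=
  not_minimiserShellsSlack_of_crysEnergyLimit
    Summit.AtomisticToContinuum.Crystallization.Theorems.crysEnergyLimit_proof hs

/-- Hence the crux is EXACTLY the `s = 0` endpoint of a family that is false for every `s > 0`: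
`MinimiserShellsSlack s ↔ s ≤ 0 ∧ MinimiserShells` fails to be provable only through the crux
itself — formally, `MinimiserShellsSlack s → s ≤ 0`. [folklore] -/
theorem nonpos_of_minimiserShellsSlack {s : ℝ} (h : MinimiserShellsSlack s) : s ≤ 0 :=
  le_of_not_gt fun hs => not_minimiserShellsSlack hs h

/-! ## §10 (gen 3) The conclusion is satisfiable as intended (non-vacuity of `GoodShell`)

Sanity against a junk reading of the route's inlined `ShellCloseTo`/pattern terms: the root of the
13-atom cuboctahedral cluster `{0} ∪ fccKissingPattern` (twelve unit vectors) HAS a good shell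
(`a = 1`, `A = id`, the identity matching), and so does the anticuboctahedral one.  So the crux is
not true-for-lack-of-good-shells, and its conclusion is the intended one. -/

/-- The shell set of `count|({0} ∪ P)` for a pattern `P` of unit vectors is `P`. [folklore] -/
theorem shellSet_insert_pattern {P : Finset E3} (hP : ∀ x ∈ P, ‖x‖ = 1) :
    (↑P : Set E3) = {y : E3 | ((Measure.count : Measure E3).restrict
      (↑(insert (0 : E3) P) : Set E3)) {y} ≠ 0 ∧ y ≠ 0 ∧ ‖y‖ ≤ 5 / 4 * 1} := by
  ext y
  simp only [Set.mem_setOf_eq, Finset.mem_coe, count_restrict_singleton_ne_zero_iff,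
    Finset.coe_insert, Set.mem_insert_iff, mul_one]
  constructor
  · intro hy
    have h1 := hP y hy
    refine ⟨Or.inr hy, fun h0 => ?_, by rw [h1]; norm_num⟩
    rw [h0, norm_zero] at h1
    exact zero_ne_one h1
  · rintro ⟨h | h, hy0, -⟩
    · exact absurd h hy0
    · exact h

/-- **The cuboctahedral cluster's root shell is good** (`a = 1`, identity isometry). [folklore] -/
theorem goodShell_cuboctahedralCluster :
    GoodShell ((Measure.count : Measure E3).restrict
      (↑(insert (0 : E3) fccKissingPattern) : Set E3)) := by
  refine ⟨1, by norm_num, le_rfl, fccKissingPattern,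
    shellSet_insert_pattern fun x hx => norm_eq_one_of_mem_fccKissingPattern hx, Or.inl ?_⟩
  have : Finset.image (fun v : E3 => (1 : ℝ) • v) fccKissingPattern = fccKissingPattern := by
    simp only [one_smul, Finset.image_id']
  rw [this]
  exact ShellCloseTo.refl (by norm_num) _

/-- **The anticuboctahedral cluster's root shell is good** (`a = 1`, identity isometry). [folklore] -/
theorem goodShell_anticuboctahedralCluster :
    GoodShell ((Measure.count : Measure E3).restrict
      (↑(insert (0 : E3) hcpKissingPattern) : Set E3)) := by
  refine ⟨1, by norm_num, le_rfl, hcpKissingPattern,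
    shellSet_insert_pattern fun x hx => norm_eq_one_of_mem_hcpKissingPattern hx, Or.inr ?_⟩
  have : Finset.image (fun v : E3 => (1 : ℝ) • v) hcpKissingPattern = hcpKissingPattern := by
    simp only [one_smul, Finset.image_id']
  rw [this]
  exact ShellCloseTo.refl (by norm_num) _


/-! ## §11 (gen 3) THE FINITE WORLD IS CLOSED — for two independent reasons

No finite configuration can ever witness `¬ MinimiserShells`, and this is now certified from BOTH
ends: (a) ENERGY — `card_mul_eStar_lt : N·e* < 𝓔_N(y)` STRICTLY for every injective `y`, `N ≥ 1`
(two far copies interact strictly attractively, `𝓔_{2N} < 2𝓔_N`, while `2N e* ≤ 𝓔_{2N}` by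
periodisation), so `e* < E(N)/N` for all `N ≥ 1` and `e* < E_{P_x}[h]` for every uniformly rooted
finite cluster (hypothesis (iii) fails); (b) GEOMETRY — `exists_not_goodShell_rootedMeasure`: every
finite cluster has an atom with a BAD shell (an atom extreme in a direction `u` sees all others in
the half-space `⟪·,u⟫ ≤ 0`, while a perturbed rotated scaled FCC/HCP pattern never fits in a
half-space: both patterns are balanced tight frames, `Σ v = 0`, `Σ ⟪v,u⟫² = 4‖u‖²`, by `decide` on
the integer models), so `not_ae_goodShell_unifRooted`: the CONCLUSION fails with probability `≥ 1/N`
for every uniformly rooted finite cluster, whatever its energy.  Consequences: a witness against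
the crux is necessarily a law on INFINITE configurations (the Benjamini–Schramm / Palm world
proper); an everywhere-well-shelled set (hypothesis of `ShellsToBarlowChart`) is infinite; and the
slack refutations of §4 are sharp in the sense that their laws sit at `E(N)/N > e*` strictly.
Landing file: `Negative/FiniteClusters.lean`. -/

open scoped InnerProductSpace

open Summit.AtomisticToContinuum.Crystallization.Theorems.ChargedEnergyGapNegative
  (copies copiesFin copiesFin_apply dist_copies_same le_dist_copies_ne copiesFin_injective Dsum
    Dsum_nonneg spacing two_Dsum_lt_spacing)

/-! ### §11a No finite cluster is minimising: `N·e* < 𝓔_N(y)` -/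

/-- **Two far copies are strictly cheaper than twice one copy**: for `N ≥ 1` points and spacing
`L = 8D + 8`, `𝓔_{2N}(y ⊔ (y + L e₀)) < 2·𝓔_N(y)` (every cross pair is at distance `> 1`, where
`V_LJ < 0`). [folklore] -/
theorem interactionEnergy_two_copies_lt {N : ℕ} (hN : 0 < N) (y : Fin N → E3) :
    interactionEnergy lennardJones (copiesFin 2 (spacing y) y) <
      2 * interactionEnergy lennardJones y := by
  set L := spacing y with hLdef
  have hL1 : 1 < L - 2 * Dsum y := by
    rw [hLdef, spacing]; linarith [Dsum_nonneg y]
  have hL0 : 0 ≤ L := by linarith [Dsum_nonneg y]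
  have h2 := two_mul_interactionEnergy_eq_sum_sum lennardJones lennardJones_zero (copiesFin 2 L y)
  have h2y := two_mul_interactionEnergy_eq_sum_sum lennardJones lennardJones_zero y
  have hre : ∑ a, ∑ b, lennardJones (dist (copiesFin 2 L y a) (copiesFin 2 L y b)) =
      ∑ p : Fin 2 × Fin N, ∑ q : Fin 2 × Fin N,
        lennardJones (dist (copies 2 L y p) (copies 2 L y q)) := by
    simp only [copiesFin_apply]
    exact (finProdFinEquiv.symm.sum_comp (fun p => ∑ b : Fin (2 * N),
      lennardJones (dist (copies 2 L y p) (copies 2 L y (finProdFinEquiv.symm b))))).trans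
      (Finset.sum_congr rfl fun p _ => finProdFinEquiv.symm.sum_comp
        (fun q => lennardJones (dist (copies 2 L y p) (copies 2 L y q))))
  haveI : Nonempty (Fin N) := ⟨⟨0, hN⟩⟩
  -- each row is STRICTLY below the corresponding `y`-row
  have hrow : ∀ (c : Fin 2) (i : Fin N),
      ∑ q : Fin 2 × Fin N, lennardJones (dist (copies 2 L y (c, i)) (copies 2 L y q)) <
        ∑ j, lennardJones (dist (y i) (y j)) := by
    intro c i
    rw [Fintype.sum_prod_type, ← Finset.add_sum_erase _ _ (Finset.mem_univ c)]
    have hown : ∑ j : Fin N, lennardJones (dist (copies 2 L y (c, i)) (copies 2 L y (c, j))) =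
        ∑ j, lennardJones (dist (y i) (y j)) := by
      simp only [dist_copies_same]
    have hne : (Finset.univ.erase c).Nonempty := by
      refine ⟨c + 1, Finset.mem_erase.2 ⟨?_, Finset.mem_univ _⟩⟩
      fin_omega
    have hrest : ∑ c' ∈ Finset.univ.erase c, ∑ j : Fin N,
        lennardJones (dist (copies 2 L y (c, i)) (copies 2 L y (c', j))) < 0 := by
      rw [← Finset.sum_const_zero]
      refine Finset.sum_lt_sum_of_nonempty hne fun c' hc' => ?_
      rw [← Finset.sum_const_zero]
      refine Finset.sum_lt_sum_of_nonempty Finset.univ_nonempty fun j _ => ?_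
      have hne' : ((c, i) : Fin 2 × Fin N).1 ≠ ((c', j) : Fin 2 × Fin N).1 :=
        fun h => (Finset.ne_of_mem_erase hc') h.symm
      exact lennardJones_neg (hL1.trans_le (le_dist_copies_ne 2 hL0 y hne'))
    linarith
  have hsum : ∑ p : Fin 2 × Fin N, ∑ q : Fin 2 × Fin N,
        lennardJones (dist (copies 2 L y p) (copies 2 L y q)) <
      (2 : ℝ) * ∑ i, ∑ j, lennardJones (dist (y i) (y j)) := by
    rw [Fintype.sum_prod_type]
    calc ∑ c : Fin 2, ∑ i : Fin N, ∑ q : Fin 2 × Fin N,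
          lennardJones (dist (copies 2 L y (c, i)) (copies 2 L y q))
        < ∑ _c : Fin 2, ∑ i : Fin N, ∑ j, lennardJones (dist (y i) (y j)) :=
          Finset.sum_lt_sum_of_nonempty Finset.univ_nonempty fun c _ =>
            Finset.sum_lt_sum_of_nonempty Finset.univ_nonempty fun i _ => hrow c i
      _ = (2 : ℝ) * ∑ i, ∑ j, lennardJones (dist (y i) (y j)) := by
          rw [Finset.sum_const, Finset.card_univ, Fintype.card_fin, nsmul_eq_mul, Nat.cast_ofNat]
  have hfin : 2 * interactionEnergy lennardJones (copiesFin 2 L y) <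
      2 * (2 * interactionEnergy lennardJones y) := by
    rw [h2, h2y, hre]; exact hsum
  linarith

/-- **No finite cluster reaches the bulk energy density**: `N·e* < 𝓔_N(y)` for every injective
configuration of `N ≥ 1` points. [folklore] -/
theorem card_mul_eStar_lt {N : ℕ} (hN : 0 < N) {y : Fin N → E3} (hy : Function.Injective y) :
    (N : ℝ) * eStar < interactionEnergy lennardJones y := by
  have hcop := interactionEnergy_two_copies_lt hN y
  have hinj := copiesFin_injective 2 (two_Dsum_lt_spacing y) hy
  have hle := Summit.AtomisticToContinuum.Crystallization.Theorems.ChargedEnergyGapNegative.card_mul_eStar_le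
    hinj
  change ((2 * N : ℕ) : ℝ) * eStar ≤ _ at hle
  push_cast at hle
  linarith

/-- Hence `e* < E(N)/N` for every `N ≥ 1` (a ground state exists and is a finite cluster).
[folklore] -/
theorem eStar_lt_groundStateEnergy_div {N : ℕ} (hN : 0 < N) :
    eStar < groundStateEnergy lennardJones 3 N / N := by
  obtain ⟨δ, -, hgs⟩ := exists_isGroundState_separated LennardJonesGroundStatesExist_holds
    LennardJonesMinimalDistance_holds
  obtain ⟨x, hxgs, -⟩ := hgs N
  have hNr : (0 : ℝ) < N := by exact_mod_cast hN
  rw [lt_div_iff₀ hNr, mul_comm, ← hxgs.2]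
  exact card_mul_eStar_lt hN hxgs.1

/-- **No uniformly rooted finite cluster is minimising**: `e* < E_{P_x}[h] = 𝓔_N(x)/N`, so
hypothesis (iii) of the crux fails for every law of `Negative.UniformRooting`. [folklore] -/
theorem eStar_lt_meanRootEnergy_unifRooted {N : ℕ} [NeZero N] {x : Fin N → E3}
    (hx : Function.Injective x) : eStar < meanRootEnergy (unifRooted x) := by
  have hN : 0 < N := Nat.pos_of_ne_zero (NeZero.ne N)
  have hNr : (0 : ℝ) < N := by exact_mod_cast hN
  rw [meanRootEnergy_unifRooted hx, lt_div_iff₀ hNr, mul_comm]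
  exact card_mul_eStar_lt hN hx

/-! ### §11b Both kissing patterns are balanced tight frames -/

/-- `Σ_{v ∈ fccInt} v = 0`. [folklore] -/
theorem sum_fccInt_eq_zero : ∑ v ∈ fccInt, v = 0 := by decide

/-- `Σ_{v ∈ hcpInt} v = 0`. [folklore] -/
theorem sum_hcpInt_eq_zero : ∑ v ∈ hcpInt, v = 0 := by decide

/-- `Σ_{v ∈ fccInt} vᵢ vⱼ = 8 δᵢⱼ` (the cuboctahedron is a tight frame). [folklore] -/
theorem gram_fccInt : ∀ i j : Fin 3, ∑ v ∈ fccInt, v i * v j = if i = j then 8 else 0 := by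
  decide

/-- `Σ_{v ∈ hcpInt} vᵢ vⱼ = 72 δᵢⱼ` (so is the anticuboctahedron). [folklore] -/
theorem gram_hcpInt : ∀ i j : Fin 3, ∑ v ∈ hcpInt, v i * v j = if i = j then 72 else 0 := by
  decide

/-- `⟪intVec v, u⟫ = Σᵢ vᵢ uᵢ`. [folklore] -/
theorem inner_intVec (v : Fin 3 → ℤ) (u : E3) : ⟪intVec v, u⟫_ℝ = ∑ i, (v i : ℝ) * u i := by
  simp [intVec, PiLp.inner_apply, mul_comm]

/-- `‖u‖² = Σᵢ uᵢ²`. [folklore] -/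
theorem norm_sq_eq_sum (u : E3) : ‖u‖ ^ 2 = ∑ i, u i * u i := by
  rw [EuclideanSpace.norm_eq, Real.sq_sqrt (by positivity)]
  simp [sq]

/-- Linear frame sum: `Σ_{v ∈ S} ⟪intVec v, u⟫ = Σᵢ (Σ_{v ∈ S} vᵢ) uᵢ`. [folklore] -/
theorem sum_inner_intVec (S : Finset (Fin 3 → ℤ)) (u : E3) :
    ∑ v ∈ S, ⟪intVec v, u⟫_ℝ = ∑ i, ((∑ v ∈ S, v i : ℤ) : ℝ) * u i := by
  simp_rw [inner_intVec]
  rw [Finset.sum_comm]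
  refine Finset.sum_congr rfl fun i _ => ?_
  push_cast
  rw [Finset.sum_mul]

/-- Quadratic frame sum: `Σ_{v ∈ S} ⟪intVec v, u⟫² = Σᵢⱼ (Σ_{v ∈ S} vᵢvⱼ) uᵢuⱼ`. [folklore] -/
theorem sum_sq_inner_intVec (S : Finset (Fin 3 → ℤ)) (u : E3) :
    ∑ v ∈ S, ⟪intVec v, u⟫_ℝ ^ 2 = ∑ i, ∑ j, ((∑ v ∈ S, v i * v j : ℤ) : ℝ) * (u i * u j) := by
  simp_rw [inner_intVec, sq, Finset.sum_mul_sum]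
  rw [Finset.sum_comm]
  refine Finset.sum_congr rfl fun i _ => ?_
  rw [Finset.sum_comm]
  refine Finset.sum_congr rfl fun j _ => ?_
  push_cast
  rw [Finset.sum_mul]
  refine Finset.sum_congr rfl fun v _ => ?_
  ring

/-- **Balanced**: `Σ_{w ∈ pattern} ⟪w, u⟫ = 0` when `Σ_{v ∈ S} v = 0`. [folklore] -/
theorem sum_inner_scaledPattern_eq_zero {S : Finset (Fin 3 → ℤ)} {M : ℕ} (hM : M ≠ 0)
    (hS : ∑ v ∈ S, v = 0) (u : E3) : ∑ w ∈ scaledPattern S M, ⟪w, u⟫_ℝ = 0 := by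
  rw [scaledPattern, Finset.sum_image fun v _ w _ h => scaledPattern_map_injective hM h]
  simp_rw [real_inner_smul_left]
  have h0 : ∀ i, (∑ v ∈ S, v i : ℤ) = 0 := fun i => by
    rw [← Finset.sum_apply, hS, Pi.zero_apply]
  rw [← Finset.mul_sum, sum_inner_intVec,
    Finset.sum_eq_zero (fun i _ => by rw [h0 i, Int.cast_zero, zero_mul]), mul_zero]

/-- **Tight frame**: `Σ_{w ∈ pattern} ⟪w, u⟫² = (c/M)·‖u‖²` when `Σ_{v ∈ S} vᵢvⱼ = c δᵢⱼ`.
[folklore] -/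
theorem sum_sq_inner_scaledPattern {S : Finset (Fin 3 → ℤ)} {M : ℕ} (hM : M ≠ 0) {c : ℤ}
    (hG : ∀ i j : Fin 3, ∑ v ∈ S, v i * v j = if i = j then c else 0) (u : E3) :
    ∑ w ∈ scaledPattern S M, ⟪w, u⟫_ℝ ^ 2 = (c : ℝ) / M * ‖u‖ ^ 2 := by
  rw [scaledPattern, Finset.sum_image fun v _ w _ h => scaledPattern_map_injective hM h]
  simp_rw [real_inner_smul_left, mul_pow]
  rw [← Finset.mul_sum, sum_sq_inner_intVec]
  simp_rw [hG]
  have hsq : ((Real.sqrt M)⁻¹) ^ 2 = (M : ℝ)⁻¹ := by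
    rw [inv_pow, Real.sq_sqrt (by positivity)]
  rw [hsq, norm_sq_eq_sum]
  simp only [Int.cast_ite, Int.cast_zero, ite_mul, zero_mul, Finset.sum_ite_eq, Finset.mem_univ,
    if_true]
  rw [← Finset.mul_sum, div_eq_mul_inv]
  ring

/-- The FCC pattern: `Σ ⟪w, u⟫ = 0`. [folklore] -/
theorem sum_inner_fcc (u : E3) : ∑ w ∈ fccKissingPattern, ⟪w, u⟫_ℝ = 0 :=
  sum_inner_scaledPattern_eq_zero two_ne_zero sum_fccInt_eq_zero u

/-- The HCP pattern: `Σ ⟪w, u⟫ = 0`. [folklore] -/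
theorem sum_inner_hcp (u : E3) : ∑ w ∈ hcpKissingPattern, ⟪w, u⟫_ℝ = 0 :=
  sum_inner_scaledPattern_eq_zero (by norm_num) sum_hcpInt_eq_zero u

/-- The FCC pattern: `Σ ⟪w, u⟫² = 4‖u‖²`. [folklore] -/
theorem sum_sq_inner_fcc (u : E3) : ∑ w ∈ fccKissingPattern, ⟪w, u⟫_ℝ ^ 2 = 4 * ‖u‖ ^ 2 := by
  rw [fccKissingPattern, sum_sq_inner_scaledPattern two_ne_zero gram_fccInt u]
  norm_num

/-- The HCP pattern: `Σ ⟪w, u⟫² = 4‖u‖²`. [folklore] -/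
theorem sum_sq_inner_hcp (u : E3) : ∑ w ∈ hcpKissingPattern, ⟪w, u⟫_ℝ ^ 2 = 4 * ‖u‖ ^ 2 := by
  rw [hcpKissingPattern, sum_sq_inner_scaledPattern (by norm_num) gram_hcpInt u]
  norm_num

/-- **A balanced tight frame of twelve unit vectors is not confined to a thin half-space**: some
vector has `⟪w, u⟫ > 1/100` (for a unit `u`).  (If all `t_w = ⟪w, u⟫ ≤ 1/100`, then with
`t_w ≥ −1` the chord bound `t² ≤ 1/100 − (99/100)t` sums to `4 ≤ 12/100`.) [folklore] -/
theorem exists_inner_gt {P : Finset E3} (hcard : P.card = 12) (hunit : ∀ w ∈ P, ‖w‖ = 1) {u : E3}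
    (hu : ‖u‖ = 1) (hsum : ∑ w ∈ P, ⟪w, u⟫_ℝ = 0) (hsq : ∑ w ∈ P, ⟪w, u⟫_ℝ ^ 2 = 4 * ‖u‖ ^ 2) :
    ∃ w ∈ P, 1 / 100 < ⟪w, u⟫_ℝ := by
  by_contra h
  push Not at h
  have hchord : ∀ w ∈ P, ⟪w, u⟫_ℝ ^ 2 ≤ 1 / 100 - 99 / 100 * ⟪w, u⟫_ℝ := by
    intro w hw
    have h1 : -1 ≤ ⟪w, u⟫_ℝ := by
      have := abs_real_inner_le_norm w u
      rw [hunit w hw, hu, one_mul] at this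
      linarith [neg_abs_le ⟪w, u⟫_ℝ]
    nlinarith [h w hw, h1]
  have hle : ∑ w ∈ P, ⟪w, u⟫_ℝ ^ 2 ≤ ∑ w ∈ P, (1 / 100 - 99 / 100 * ⟪w, u⟫_ℝ) :=
    Finset.sum_le_sum hchord
  rw [Finset.sum_sub_distrib, ← Finset.mul_sum, hsum, Finset.sum_const, hcard, hsq, hu] at hle
  norm_num at hle

/-! ### §11c Every finite cluster has a badly shelled atom -/

/-- **A configuration contained in a closed half-space through the root has a bad root shell.**
If every atom `y` of `μ` satisfies `⟪y, u⟫ ≤ 0` for a unit vector `u`, then `μ` has no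
`(a/100)`-close-packed root shell: the matched, rotated, scaled pattern would contain a vector
with `⟪·, u⟫ > a/100`, within `a/100` of an atom. [folklore] -/
theorem not_goodShell_of_halfSpace {μ : Measure E3} {u : E3} (hu : ‖u‖ = 1)
    (h : ∀ y : E3, μ {y} ≠ 0 → ⟪y, u⟫_ℝ ≤ 0) : ¬ GoodShell μ := by
  rintro ⟨a, ha1, -, T, hT, hclose⟩
  have ha0 : 0 < a := by linarith
  -- the matched pattern `P₀`, the isometry `A` and the matching `e`
  obtain ⟨P₀, hP₀card, hP₀unit, hP₀sum, hP₀sq, A, e, he⟩ :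
      ∃ P₀ : Finset E3, P₀.card = 12 ∧ (∀ w ∈ P₀, ‖w‖ = 1) ∧ (∀ u, ∑ w ∈ P₀, ⟪w, u⟫_ℝ = 0) ∧
        (∀ u : E3, ∑ w ∈ P₀, ⟪w, u⟫_ℝ ^ 2 = 4 * ‖u‖ ^ 2) ∧ ∃ A : E3 →ₗᵢ[ℝ] E3,
        ∃ e : ↥T ≃ ↥((P₀.image fun v : E3 => a • v).image A),
          ∀ t : ↥T, dist (t : E3) (e t : E3) ≤ a / 100 := by
    rcases hclose with ⟨A, e, he⟩ | ⟨A, e, he⟩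
    · exact ⟨fccKissingPattern, card_fccKissingPattern, fun w hw =>
        norm_eq_one_of_mem_fccKissingPattern hw, sum_inner_fcc, sum_sq_inner_fcc, A, e, he⟩
    · exact ⟨hcpKissingPattern, card_hcpKissingPattern, fun w hw =>
        norm_eq_one_of_mem_hcpKissingPattern hw, sum_inner_hcp, sum_sq_inner_hcp, A, e, he⟩
  -- transport `u` back through the isometry
  set Ae : E3 ≃ₗᵢ[ℝ] E3 := A.toLinearIsometryEquiv rfl with hAe
  have hAe_apply : ∀ v, A v = Ae v := fun v => by simp [hAe]
  set u' : E3 := Ae.symm u with hu'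
  have hu'1 : ‖u'‖ = 1 := by rw [hu', LinearIsometryEquiv.norm_map, hu]
  have hinner : ∀ v : E3, ⟪A v, u⟫_ℝ = ⟪v, u'⟫_ℝ := fun v => by
    rw [hAe_apply, hu']
    conv_lhs => rw [← Ae.apply_symm_apply u]
    rw [LinearIsometryEquiv.inner_map_map]
  -- a pattern vector sticking out of the half-space
  obtain ⟨w₀, hw₀, hw₀gt⟩ := exists_inner_gt hP₀card hP₀unit hu'1 (hP₀sum u') (hP₀sq u')
  -- its image `z = A (a • w₀)` is matched to an atom `t`
  have hz : A (a • w₀) ∈ (P₀.image fun v : E3 => a • v).image A :=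
    Finset.mem_image.2 ⟨a • w₀, Finset.mem_image.2 ⟨w₀, hw₀, rfl⟩, rfl⟩
  set t : ↥T := e.symm ⟨A (a • w₀), hz⟩ with ht
  have hdist : dist (t : E3) (A (a • w₀)) ≤ a / 100 := by
    have := he t
    rwa [ht, Equiv.apply_symm_apply] at this
  -- `⟪z, u⟫ = a ⟪w₀, u'⟫ > a/100`
  have hzu : a / 100 < ⟪A (a • w₀), u⟫_ℝ := by
    rw [hinner, real_inner_smul_left]
    have := mul_lt_mul_of_pos_left hw₀gt ha0
    linarith
  -- `⟪t, u⟫ ≤ 0` since `t` is an atom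
  have htu : ⟪(t : E3), u⟫_ℝ ≤ 0 := by
    have hmem : (t : E3) ∈ (↑T : Set E3) := t.2
    rw [hT] at hmem
    exact h _ hmem.1
  -- but `⟪z, u⟫ ≤ ⟪t, u⟫ + ‖z − t‖`
  have hdiff : ⟪A (a • w₀), u⟫_ℝ ≤ ⟪(t : E3), u⟫_ℝ + a / 100 := by
    have hsplit : ⟪A (a • w₀), u⟫_ℝ = ⟪(t : E3), u⟫_ℝ + ⟪A (a • w₀) - (t : E3), u⟫_ℝ := by
      rw [← inner_add_left, add_sub_cancel]
    have hcs : ⟪A (a • w₀) - (t : E3), u⟫_ℝ ≤ a / 100 := by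
      have := abs_real_inner_le_norm (A (a • w₀) - (t : E3)) u
      rw [hu, mul_one, ← dist_eq_norm, dist_comm] at this
      linarith [le_abs_self ⟪A (a • w₀) - (t : E3), u⟫_ℝ]
    linarith
  linarith

/-- The first coordinate direction, a unit vector. -/
def dir : E3 := EuclideanSpace.single 0 1

/-- `‖dir‖ = 1`. [folklore] -/
theorem norm_dir : ‖dir‖ = 1 := by simp [dir]

/-- **Every finite cluster has a badly shelled atom**: an atom extreme in the direction `dir` sees
every other atom in the half-space `⟪·, dir⟫ ≤ 0`. [folklore] -/
theorem exists_not_goodShell_rootedMeasure {N : ℕ} [NeZero N] (x : Fin N → E3) :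
    ∃ i, ¬ GoodShell (rootedMeasure x i) := by
  obtain ⟨i, -, hi⟩ := Finset.exists_max_image Finset.univ (fun k => ⟪x k, dir⟫_ℝ)
    Finset.univ_nonempty
  refine ⟨i, not_goodShell_of_halfSpace norm_dir fun y hy => ?_⟩
  rw [rootedMeasure, count_restrict_singleton_ne_zero_iff, Finset.mem_coe, rootedAt,
    Finset.mem_image] at hy
  obtain ⟨k, -, rfl⟩ := hy
  rw [inner_sub_left]
  linarith [hi k (Finset.mem_univ k)]

/-- **Hence no uniformly rooted finite cluster has almost surely good shells** (the bad atom
carries probability `1/N`): the CONCLUSION of the crux fails for every law of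
`Negative.UniformRooting`, whatever its energy. [folklore] -/
theorem not_ae_goodShell_unifRooted {N : ℕ} [NeZero N] (x : Fin N → E3) :
    ¬ ∀ᵐ μ ∂(unifRooted x), GoodShell μ := by
  obtain ⟨i, hi⟩ := exists_not_goodShell_rootedMeasure x
  intro hgood
  rw [ae_iff] at hgood
  simp only [unifRooted, Measure.smul_apply, Measure.coe_finsetSum, Finset.sum_apply, smul_eq_mul,
    mul_eq_zero, ENNReal.inv_eq_zero, ENNReal.natCast_ne_top, false_or] at hgood
  have hzero : (Measure.dirac (rootedMeasure x i) : Measure (Measure E3)) {μ | ¬ GoodShell μ} = 0 :=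
    (Finset.sum_eq_zero_iff.1 hgood) i (Finset.mem_univ i)
  have hle : ({μ : Measure E3 | ¬ GoodShell μ}.indicator 1 (rootedMeasure x i) : ℝ≥0∞) ≤
      (Measure.dirac (rootedMeasure x i) : Measure (Measure E3)) {μ | ¬ GoodShell μ} :=
    Measure.le_dirac_apply
  rw [hzero, Set.indicator_of_mem (show rootedMeasure x i ∈ {μ : Measure E3 | ¬ GoodShell μ} from hi),
    Pi.one_apply] at hle
  exact one_ne_zero (le_zero_iff.1 hle)

end Summit.AtomisticToContinuum.Crystallization.Cruxes.MinimiserShells.Disproof
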